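import Mathlib
import Literature.MathematicalPhysics.QuantumFieldTheory.Balaban1983to89.T4PathwiseCoupling

/-!
# T4PathwiseCouplingComplex — NE1′ by COUPLING OF BLOCK-SPIN TOWERS, item (A4) of `T4PathwiseCoupling`: the dressing
# factor OFF THE REAL AXIS — `Z(t) = E_ν[e^{tS}]` of a bounded centred variable is ENTIRE, NON-VANISHING on the disc
# `‖t‖ < 1/‖S‖_∞`, and its logarithm obeys `‖log Z(t)‖ ≤ 8·B·‖t‖²` on `‖t‖ < 1/(2‖S‖_∞)` from the REAL sub-Gaussian
# bound `E_ν[e^{sS}] ≤ e^{B s²}` alone (quadratic Borel–Carathéodory) — so the ℓ²-budget `B = ½Σσ_i²` of the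
# conditional Azuma–Hoeffding sandwich (AZ) controls the COMPLEX dressing parameter with radii uniform in the depth `K`
(cell `pub-balaban`, T4-DAG v16 §2 node O3b / hypothesis H2, estimate NE1′, carver row `T4-O3.E-NE1′-PROVE-P2*`;
journal CLAIM `T4-O3.E-NE1′-PROVE-P2b*` 2026-08-19T07:54:46Z, unit `b2b-balaban-t4-ne1p-p2-g2` = generation 2 of the
prover seat P2 «coupling of block-spin towers»; kernel module = [folklore] complex analysis + probability over Mathlib;
NO physical input is proved or assumed here; v1 p184962 = §1–§3; v2 = v1 with the sign hypotheses `0 ≤ B` / `0 ≤ V`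
REMOVED (derived: `subGaussianConst_nonneg`) + §4, the `condExpKernel` bridge from the landed a.e. sandwiches; v3 = v2
UNCHANGED (§1–§4) + §5–§7, the ℓ¹-POLYDISC version for a FINITE FAMILY of sources with complex weights — the format of
T4-DAG H2 / O4, «finite family of loop labels C ∈ 𝒞, analytic dependence on μ on the μ₀-polydisc»)

HONEST FRAMING (cell `pub-balaban`, T4-DAG PAGE 1).  The cell's T4 target is the existence AND uniqueness of the
continuum (`ε = L^{-K} → 0`) limit of Bałaban's unit-scale averaged Wilson-loop expectations on a FIXED FINITE TORUS —
strictly beyond ultraviolet stability ([Balaban1989LargeFieldII] Thm 1 p. 355); it is FINITE VOLUME, asserts NO MASS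
GAP, and is NOT the Clay problem.  Every use of the cell's spine is CONDITIONAL on the named hypotheses `BetaPertH`
(the perturbative β-function input), `(B)` (ultraviolet stability as printed) and `(B^μ)` (its dressed form); none of
them occurs below, even as a binder: this module is pure [folklore] mathematics (moment generating functions of bounded
random variables, the Borel–Carathéodory and Schwarz lemmas) typed so that it plugs onto the real-`t` sandwiches of
`T4PathwiseCoupling` §3.  Value = kernel-checked analytic bookkeeping for the COMPLEX dressing / coupling parameter that
the cell's uniqueness step (T4-DAG U5, `T4HybridMatching`: `log Z_K(μ)` on a complex disc `|μ| ≤ μ₀`) consumes; NOT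
summit progress; NOT a proof of NE1′.

CITATION HEADER (lean-in-tree rule 2026-08-18).  NO statement of the audited series [Balaban1985Averaging] –
[Balaban1989LargeFieldII] is asserted, quoted as a hypothesis, or used below; the manuscripts are the object of the
audit and are NOT cited for any step (cell ABSOLUTE RULE).  Nothing is cited at all: every theorem below is proved in
the kernel from Mathlib (`Complex.borelCaratheodory_zero`, `Complex.dist_le_mul_div_pow_of_mapsTo_ball_of_isLittleO`,
`ProbabilityTheory.hasDerivAt_complexMGF`, `ProbabilityTheory.norm_complexMGF_le_mgf`).

## THE POINT (header item (A4) of `T4PathwiseCoupling`, «COMPLEX t / μ-UNIFORM RADII … not typed here»)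

`T4PathwiseCoupling` realises the dressed tower `(ℝT)^K(ρ₀·e^{tf})` as the undressed one reweighted by `e^{tf}` on ONE
path space and proves, for REAL `t`, the conditional Azuma–Hoeffding sandwich
  (AZ)  `exp(t·h) ≤ μ[e^{tf} ∣ F n] ≤ exp(t·h)·exp(t²·Σ_{i<n}σ_i²/2)`,  `h = μ[f ∣ F n]`, `|f| ≤ R`,
(`condExp_exp_dressing_sandwich`; variance form `…_of_condVar` for `|t|·2R ≤ 1`).  The cell needs the dressing /
coupling parameter COMPLEX (T4-DAG U5: uniqueness by analyticity of `log Z_K` in the coupling `μ`, Vitali / hybrid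
matching on a disc of `K`-independent radius).  A DIRECT complex-`t` expansion of `E[∏ e^{tY_i} ∣ endpoint]` costs the
ℓ¹ budget `Σ_i ‖Y_i‖_∞` — which DIVERGES in the cell's dictionary (`Σ_n L^{4n}θ₁ⁿ`, T4-DAG O3a v3 COUNT CORRECTION;
header of `T4PathwiseCoupling`, «THE TECHNIQUE») — whereas (AZ) costs only the ℓ² budget `Σσ_i²`.  THIS MODULE shows
that the ℓ² budget ALSO controls complex `t`, with NO further input: read (AZ) on a fibre of the endpoint (a
probability measure `ν`; centre `S = f − E_ν f`, so `|S| ≤ b := 2R`, `E_ν S = 0`, `E_ν e^{sS} ≤ e^{B s²}` for real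
`s`, `B = ½Σσ_i²`); then

  (CZ)  `Z(t) := E_ν[e^{tS}]` is entire, `Re Z(t) ≥ e^{-1}cos 1 > 0` for `‖t‖·b ≤ 1` (so `Z ≠ 0`, `log Z` holomorphic
        on the disc `‖t‖ < b⁻¹`), `log Z(0) = 0`, `(log Z)'(0) = E_ν S = 0`, `Re log Z(t) = log‖Z(t)‖ ≤ log E_ν e^{(Re t)S}
        ≤ B (Re t)² ≤ B‖t‖²`; and the QUADRATIC BOREL–CARATHÉODORY inequality (§1: a holomorphic `G` on `‖z‖ < r` with
        `G(0) = G'(0) = 0` and `Re G ≤ A` has `‖G(z)‖ ≤ 8A‖z‖²/r²` on `‖z‖ < r/2`) gives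
        `‖log Z(t)‖ ≤ 8·B·‖t‖²`   for `‖t‖ < 1/(2b) = 1/(4R)`,
  i.e.  `E_ν[e^{tf}] = e^{t·E_ν f} · e^{Ψ(t)}`, `‖Ψ(t)‖ ≤ 8B‖t‖² = 4‖t‖²·Σσ_i²` (`complexMGF_dressing_eq_exp`).

So the fluctuation channel `Ψ` of (AZ) is holomorphic in the complex dressing parameter on a disc of radius `1/(4R)`
— `R = ‖W‖_∞ ≤ 1` for a Wilson loop, INDEPENDENT of `K` and of the realised geometry — with the SAME ℓ² budget as on
the real axis (constant 8 instead of ½).  The crude bound of `T4PathwiseCoupling.dressingFactor_crude_sandwich`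
(`e^{-|t|R} ≤ μ[e^{tf}∣m] ≤ e^{|t|R}`, real `t`) extends trivially (`‖E_ν e^{tf}‖ ≤ e^{‖t‖R}`, radius ∞) but carries no
ℓ² information; (CZ) is the informative version.  WHAT (CZ) DOES NOT DO: it does not touch the two located missing
inequalities (MI-F1)/(MI-F2) of `T4PathwiseCoupling` (the ℓ² budget itself) nor the mean channel (MI-3); it removes
item (A4) from that module's list of untyped steps, nothing more.  The passage from the a.e. conditional sandwiches of
`T4PathwiseCoupling` §3 to the fibre measures `ν` (regular conditional distributions given the endpoint σ-algebra,
`ProbabilityTheory.condExpKernel` on a standard Borel path space) is §4 (`ae_condExpKernel_dressing_eq_exp`; the only inputs are Mathlib's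
`condExp_ae_eq_integral_condExpKernel`, countability of `ℚ` and continuity of `s ↦ E_ν e^{sf}`): §1–§3 are stated for
an arbitrary probability measure `ν` and a bounded centred `S` (the form the consumer uses fibrewise), §4 reads the
a.e. sandwiches of `T4PathwiseCoupling` §3 (`IncrementBound` / `IncrementVarBound`) on the fibres of the endpoint and
returns, for each complex `t` in the disc, `μ[e^{tf} ∣ F n] = e^{t·μ[f∣F n]}·e^{Ψ_t}` a.e., `‖Ψ_t‖ ≤ 4‖t‖²Σσ_i²`
(resp. `8‖t‖²Σv_i`) — the (A4) form of (AZ).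

THE POLYDISC (v3, §5–§7; variance form v4, §7b).  H2 / O4 dress a FINITE FAMILY of loops `C ∈ 𝒞` with complex weights `z_C`, `|z_C| ≤ μ₀`, and
want joint analyticity on the polydisc.  One complex variable suffices: along the complex line through `z`,
`Y := Σ_C z_C (f_C − E_ν f_C)` is a bounded CENTRED ℂ-valued variable (`‖Y‖ ≤ 2Σ_C‖z_C‖R_C`), `t ↦ E_ν[e^{tY}]` is entire
(differentiation under the integral), in the sector `Re ≥ e^{-1}cos 1` for `‖t‖·‖Y‖_∞ ≤ 1`, and `Re log E_ν[e^{tY}] ≤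
log E_ν e^{Re(tY)}`, where `Re(tY) = Σ_C Re(t z_C)(f_C − E_ν f_C)` is a REAL combination — controlled by (AZ) for the real
observable `Σ_C a_C f_C`, whose Doob–Lévy increments are the combinations of the increments (`incr` is linear a.e.), so
`IncrementBound` holds with widths `Σ_C |a_C| σ_{C,i}` (`incrementBound_linearCombination`).  Quadratic Borel–Carathéodory at
`t = 1` (admissible iff `2Σ_C‖z_C‖R_C < 1/2`):
  (CZ^𝒞)  `E_ν[exp(Σ_C z_C f_C)] = exp(Σ_C z_C E_ν f_C) · e^{Ψ(z)}`,  `‖Ψ(z)‖ ≤ 4·Σ_{i<n}(Σ_C ‖z_C‖ σ_{C,i})²`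
          on the ℓ¹-polydisc `Σ_C ‖z_C‖ R_C < 1/4`
(`multiSource_dressing_eq_exp`; on the fibres of the endpoint, a.e. and simultaneously for ALL such `z`:
`ae_condExpKernel_multiSource_eq_exp_of_incrementBound`; conditional form `ae_condExp_cexp_multiSource_of_incrementBound`).
For `|z_C| ≤ μ₀` this is the polydisc `μ₀ · Σ_C R_C < 1/4`, radius INDEPENDENT of `K`; the budget is the ℓ¹(𝒞)-weighted
ℓ² budget `Σ_i(Σ_C |z_C| σ_{C,i})² ≤ (Σ_C|z_C|)²·max_C Σ_i σ_{C,i}²`.  The passage from rational to real coefficient vectors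
on a fibre is continuity of `a ↦ E_ν exp(Σ_C a_C f_C)` on `ℝ^𝒞` (dominated convergence) and density of `ℚ^𝒞`
(`DenseRange.piMap`).
VARIANCE FORM OF THE POLYDISC (v4, §7b) — no conditional Minkowski / Cauchy–Schwarz inequality is needed: for positive
constant widths `w_C` the POINTWISE weighted Cauchy–Schwarz `(Σ_C a_C Y_C)² ≤ (Σ_C |a_C| w_C) · Σ_C (|a_C|/w_C) Y_C²`
(`sq_sum_mul_le_weighted`, square-root free) has a right-hand side that the conditional expectation handles by monotonicity
and linearity alone, so `μ[(incr f_C)_i² ∣ F(i+1)] ≤ w_{C,i}²` for each `C` gives `μ[(incr Σ_C a_C f_C)_i² ∣ F(i+1)] ≤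
(Σ_C |a_C| w_{C,i})²` (`incrementVarBound_linearCombination`); with `w = √v + ε`, the variance sandwich
`condExp_exp_dressing_sandwich_of_condVar` at `t = 1` (admissible since `2Σ_C|a_C|R_C ≤ ‖τ‖·2Σ_C‖z_C‖R_C < 1`), density of
`ℚ^𝒞` in the closed set `{2Σ|a_C|R_C ≥ 1} ∪ {inequality}` and `ε ↓ 0` on each fibre:
  (CZ^𝒞-var)  `E_ν[exp(Σ_C z_C f_C)] = exp(Σ_C z_C E_ν f_C) · e^{Ψ(z)}`,  `‖Ψ(z)‖ ≤ 8·Σ_{i<n}(Σ_C ‖z_C‖ √v_{C,i})²`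
              on the same ℓ¹-polydisc `Σ_C ‖z_C‖ R_C < 1/4`
(`ae_condExpKernel_multiSource_eq_exp_of_incrementVarBound`, conditional form `ae_condExp_cexp_multiSource_of_incrementVarBound`):
range `2R_C` + CONDITIONAL VARIANCES only, no sup-oscillation input — the budget that (A1′) of `T4PathwiseCoupling` says is
the instantiable one.

## WHAT IS PROVED (all [folklore])

§1 `norm_le_mul_sq_of_mapsTo_ball` (order-2 Schwarz: `G(0)=0`, `G'(0)=0`, `‖G‖ ≤ M` on `‖z‖<r` ⇒ `‖G z‖ ≤ M(‖z‖/r)²`),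
   `norm_le_of_mapsTo_re_le` (quadratic Borel–Carathéodory: `Re G ≤ A` on `‖z‖ < r`, `G(0) = G'(0) = 0` ⇒
   `‖G z‖ ≤ 8A‖z‖²/r²` on `‖z‖ < r/2`).
§2 bounded `S` (`|S| ≤ b` a.e., finite / probability measure `ν`): `integrableExpSet_eq_univ`,
   `hasDerivAt_complexMGF_of_bounded` / `differentiable_complexMGF_of_bounded` (Z entire), `complexMGF_zero_eq_one`,
   `hasDerivAt_complexMGF_zero_of_centred` (`Z'(0) = 0` when `E_ν S = 0`), the SECTOR LEMMA `re_cexp_mul_ofReal_ge` /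
   `re_complexMGF_ge` (`e^{-1}cos 1 ≤ Re Z(t)` for `‖t‖·b ≤ 1`), `complexMGF_mem_slitPlane` / `complexMGF_ne_zero`.
§3 `differentiableOn_log_complexMGF` (on `ball 0 b⁻¹`), `re_log_complexMGF_le` (`Re log Z ≤ B‖t‖²`), the MAIN THEOREM
   `norm_log_complexMGF_le` (`‖log Z(t)‖ ≤ 8B‖t‖²` on `‖t‖ < b⁻¹/2`), `complexMGF_eq_exp` (`Z = e^Ψ`, `‖Ψ‖ ≤ 8B‖t‖²`),
   and the dressing-variable form `complexMGF_dressing_eq_exp` (`|f| ≤ R`, real sub-Gaussian bound about the mean for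
   `|s| < 1/(2R)` ⇒ `E_ν e^{tf} = e^{tE_ν f}·e^{Ψ}`, `‖Ψ‖ ≤ 8V‖t‖²` for complex `‖t‖ < 1/(4R)`);
   `one_le_mgf_of_centred` / `subGaussianConst_nonneg` (the constant `B` of a centred variable is `≥ 0` — no sign
   hypothesis is needed anywhere).
§4 `le_on_open_of_rat` (rational points of an open set suffice for an inequality of continuous functions),
   `complexMGF_dressing_eq_exp_of_rat`; on a STANDARD BOREL `Ω` with a finite `μ` and `m ≤ mΩ`:
   `condExp_exp_mul_ae_eq_mgf_condExpKernel`, `condExp_cexp_mul_ae_eq_complexMGF_condExpKernel`,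
   `condExp_ae_eq_integral_condExpKernel_of_bounded` (conditional (complex) exponential moments and means are a.e. the
   fibre ones), THE BRIDGE `ae_condExpKernel_dressing_eq_exp` (real a.e. sandwich for `|s| < 1/(2R)` ⇒ a.e. in `ω`,
   simultaneously for all complex `‖t‖ < 1/(4R)`, the fibre factorisation with `‖Ψ‖ ≤ 8V‖t‖²`), and the END-TO-END
   forms from `T4PathwiseCoupling`'s hypothesis shapes: `ae_condExpKernel_dressing_eq_exp_of_incrementBound`
   (`‖Ψ‖ ≤ 4‖t‖²Σσ_i²`), `…_of_incrementVarBound` (`‖Ψ‖ ≤ 8‖t‖²Σv_i`), `ae_condExp_cexp_dressing_of_incrementBound` /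
   `…_of_incrementVarBound` (`μ[e^{tf} ∣ F n] = e^{t·μ[f∣F n]}·e^{Ψ}` a.e., each complex `t` in the disc).
§5 complex-valued bounded `Y` (`‖Y‖ ≤ b` a.e.): `re_cexp_ge_of_norm_le_one`, `norm_cexp_mul_le`, `integrable_cexp_mul`,
   `hasDerivAt_integral_cexp_mul` / `differentiable_integral_cexp_mul` (`t ↦ E_ν e^{tY}` entire, by
   `hasDerivAt_integral_of_dominated_loc_of_deriv_le`), `integral_cexp_zero_mul`,
   `hasDerivAt_integral_cexp_mul_zero_of_centred`, `re_integral_cexp_mul_ge` (sector), `integral_cexp_mul_mem_slitPlane` /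
   `integral_cexp_mul_ne_zero`, `differentiableOn_log_integral_cexp_mul`, `re_log_integral_cexp_mul_le`,
   `one_le_integral_exp_re_ofReal_mul` / `quadConst_nonneg_of_centred` (no sign hypothesis), the MAIN THEOREM
   `norm_log_integral_cexp_mul_le` (`E_ν e^{Re(τY)} ≤ e^{B‖τ‖²}` on `‖τ‖ < b⁻¹` ⇒ `‖log E_ν e^{tY}‖ ≤ 8B‖t‖²` on
   `‖t‖ < b⁻¹/2`) and `integral_cexp_mul_eq_exp`.
§6 finite family `f_C`, `C ∈ ι` (`Fintype ι`): `re_mul_sum_mul_ofReal`, `continuous_integral_exp_sum` (continuity of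
   `a ↦ E_ν exp(Σ a_C f_C)` on `ℝ^ι`), the POLYDISC THEOREM `multiSource_dressing_eq_exp` ((CZ^𝒞) above, `‖Ψ‖ ≤ 8V` from the
   real bound `E_ν exp(Σ_C Re(τz_C)(f_C − E_ν f_C)) ≤ e^{V‖τ‖²}`).
§7 `condExp_linearCombination_ae_eq`, `incr_linearCombination_ae_eq` (the Doob–Lévy increments are linear a.e.),
   `incrementBound_linearCombination` (`IncrementBound` for each source ⇒ for every real combination, widths
   `Σ_C|a_C|σ_{C,i}`); on a standard Borel `Ω`: `ae_condExpKernel_multiSource_eq_exp_of_incrementBound` (a.e. in `ω`, for ALL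
   `z` with `Σ_C‖z_C‖R_C < 1/4`: the fibre factorisation with `‖Ψ‖ ≤ 4Σ_{i<n}(Σ_C‖z_C‖σ_{C,i})²`) and
   `ae_condExp_cexp_multiSource_of_incrementBound` (`μ[exp(Σ z_C f_C) ∣ F n] = exp(Σ z_C μ[f_C∣F n])·e^{Ψ}` a.e., each `z`).
§7b `sq_sum_mul_le_weighted` (pointwise weighted Cauchy–Schwarz), `incrementVarBound_linearCombination` (`IncrementVarBound`
   with `w_{C,i}²` for each source, `w > 0` ⇒ `IncrementVarBound` with `(Σ_C|a_C|w_{C,i})²` for every real combination); on a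
   standard Borel `Ω`: `ae_condExpKernel_multiSource_eq_exp_of_incrementVarBound` (a.e. in `ω`, for ALL `z` with
   `Σ_C‖z_C‖R_C < 1/4`: the fibre factorisation with `‖Ψ‖ ≤ 8Σ_{i<n}(Σ_C‖z_C‖√v_{C,i})²`) and
   `ae_condExp_cexp_multiSource_of_incrementVarBound` (conditional form, each `z`).

Axioms: standard (propext, Classical.choice, Quot.sound).  No `sorry`.
-/

noncomputable section

open MeasureTheory ProbabilityTheory Metric Set Filter Asymptotics
open scoped Topology

namespace Literature.MathematicalPhysics.QuantumFieldTheory.Balaban1983to89.T4PathwiseCouplingComplex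

/-! ## §1  Complex analysis: the quadratic Borel–Carathéodory inequality -/

section ComplexAnalysis

variable {G : ℂ → ℂ} {r M A : ℝ}

/-- [folklore] **Order-2 Schwarz lemma.**  `G` holomorphic on `‖z‖ < r` with values in `‖w‖ ≤ M`, `G 0 = 0` and
`G' 0 = 0` ⇒ `‖G z‖ ≤ M·(‖z‖/r)²` (Mathlib's `Complex.dist_le_mul_div_pow_of_mapsTo_ball_of_isLittleO`, `n = 1`). -/
theorem norm_le_mul_sq_of_mapsTo_ball (hd : DifferentiableOn ℂ G (ball 0 r))
    (hmaps : MapsTo G (ball 0 r) (closedBall 0 M)) (hG0 : G 0 = 0) (hG1 : HasDerivAt G 0 0)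
    {z : ℂ} (hz : z ∈ ball (0 : ℂ) r) : ‖G z‖ ≤ M * (‖z‖ / r) ^ 2 := by
  have hn : (fun w => G w - G 0) =o[𝓝 (0 : ℂ)] fun w => ‖w - 0‖ ^ 1 := by
    have h := hasDerivAt_iff_isLittleO.mp hG1
    have h' : (fun w => G w - G 0) =o[𝓝 (0 : ℂ)] fun w => w - 0 :=
      h.congr_left fun w => by simp
    exact h'.norm_right.congr_right fun w => by simp
  have hmaps' : MapsTo G (ball 0 r) (closedBall (G 0) M) := by rw [hG0]; exact hmaps
  have h := Complex.dist_le_mul_div_pow_of_mapsTo_ball_of_isLittleO (n := 1) hd hmaps' hn hz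
  simpa [hG0, dist_zero_right] using h

/-- [folklore] **Quadratic Borel–Carathéodory.**  `G` holomorphic on `‖z‖ < r`, `Re G ≤ A` there (`A > 0`),
`G 0 = 0`, `G' 0 = 0` ⇒ `‖G z‖ ≤ 8·A·‖z‖²/r²` for `‖z‖ < r/2`.  (Borel–Carathéodory gives `‖G‖ ≤ 2A` on the half
disc; the order-2 Schwarz lemma on the half disc gives the square.) -/
theorem norm_le_of_mapsTo_re_le (hr : 0 < r) (hA : 0 < A) (hd : DifferentiableOn ℂ G (ball 0 r))
    (hre : MapsTo G (ball 0 r) {w | w.re ≤ A}) (hG0 : G 0 = 0) (hG1 : HasDerivAt G 0 0)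
    {z : ℂ} (hz : ‖z‖ < r / 2) : ‖G z‖ ≤ 8 * A * ‖z‖ ^ 2 / r ^ 2 := by
  have hmaps : MapsTo G (ball 0 (r / 2)) (closedBall 0 (2 * A)) := by
    intro w hw
    have hw' : ‖w‖ < r / 2 := mem_ball_zero_iff.mp hw
    have hwr : w ∈ ball (0 : ℂ) r := mem_ball_zero_iff.mpr (by linarith)
    have h := Complex.borelCaratheodory_zero hA hd hre hr hwr hG0
    rw [mem_closedBall_zero_iff]
    have hden : 0 < r - ‖w‖ := by linarith
    calc ‖G w‖ ≤ 2 * A * ‖w‖ / (r - ‖w‖) := h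
      _ ≤ 2 * A := by
          rw [div_le_iff₀ hden]
          have : ‖w‖ * (2 * A) ≤ (r - ‖w‖) * (2 * A) :=
            mul_le_mul_of_nonneg_right (by linarith) (by linarith)
          linarith
  have h2 := norm_le_mul_sq_of_mapsTo_ball (hd.mono (ball_subset_ball (by linarith))) hmaps hG0 hG1
    (mem_ball_zero_iff.mpr hz)
  have hr0 : r ≠ 0 := hr.ne'
  calc ‖G z‖ ≤ 2 * A * (‖z‖ / (r / 2)) ^ 2 := h2
    _ = 8 * A * ‖z‖ ^ 2 / r ^ 2 := by
        field_simp
        ring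

end ComplexAnalysis

/-! ## §2  The complex moment generating function of a bounded variable: entire, and in a sector near `t = 0` -/

section BoundedMGF

variable {Ω : Type*} {mΩ : MeasurableSpace Ω} {ν : Measure Ω} {S : Ω → ℝ} {b : ℝ}

/-- [folklore] A bounded variable has exponential moments of every order: `integrableExpSet S ν = univ`. -/
theorem integrableExpSet_eq_univ [IsFiniteMeasure ν] (hSm : AEMeasurable S ν)
    (hSb : ∀ᵐ ω ∂ν, |S ω| ≤ b) : integrableExpSet S ν = Set.univ :=
  Set.eq_univ_of_forall fun _ =>
    integrable_exp_mul_of_mem_Icc hSm (hSb.mono fun _ h => Set.mem_Icc.mpr (abs_le.mp h))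

/-- [folklore] For a bounded variable every real part lies in the interior of `integrableExpSet` (= `univ`). -/
theorem re_mem_interior_integrableExpSet [IsFiniteMeasure ν] (hSm : AEMeasurable S ν)
    (hSb : ∀ᵐ ω ∂ν, |S ω| ≤ b) (z : ℂ) : z.re ∈ interior (integrableExpSet S ν) := by
  rw [integrableExpSet_eq_univ hSm hSb, interior_univ]
  exact Set.mem_univ _

/-- [folklore] `Z(t) = E_ν[e^{tS}]` of a bounded `S` is complex-differentiable at EVERY `t : ℂ`, with the expected
derivative `E_ν[S e^{tS}]`. -/
theorem hasDerivAt_complexMGF_of_bounded [IsFiniteMeasure ν] (hSm : AEMeasurable S ν)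
    (hSb : ∀ᵐ ω ∂ν, |S ω| ≤ b) (z : ℂ) :
    HasDerivAt (complexMGF S ν) (∫ ω, (S ω : ℂ) * Complex.exp (z * S ω) ∂ν) z :=
  hasDerivAt_complexMGF (re_mem_interior_integrableExpSet hSm hSb z)

/-- [folklore] `Z` is ENTIRE. -/
theorem differentiable_complexMGF_of_bounded [IsFiniteMeasure ν] (hSm : AEMeasurable S ν)
    (hSb : ∀ᵐ ω ∂ν, |S ω| ≤ b) : Differentiable ℂ (complexMGF S ν) :=
  fun z => (hasDerivAt_complexMGF_of_bounded hSm hSb z).differentiableAt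

/-- [folklore] `Z(0) = 1` under a probability measure. -/
theorem complexMGF_zero_eq_one [IsProbabilityMeasure ν] : complexMGF S ν 0 = 1 := by
  simp [complexMGF]

/-- [folklore] `Z'(0) = E_ν S`; in particular `Z'(0) = 0` for a CENTRED bounded variable. -/
theorem hasDerivAt_complexMGF_zero_of_centred [IsFiniteMeasure ν] (hSm : AEMeasurable S ν)
    (hSb : ∀ᵐ ω ∂ν, |S ω| ≤ b) (hSc : ∫ ω, S ω ∂ν = 0) : HasDerivAt (complexMGF S ν) 0 0 := by
  have h := hasDerivAt_complexMGF_of_bounded hSm hSb 0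
  have hint : ∫ ω, (S ω : ℂ) * Complex.exp (0 * (S ω : ℂ)) ∂ν = 0 := by
    simp only [zero_mul, Complex.exp_zero, mul_one]
    rw [integral_complex_ofReal, hSc]
    simp
  rwa [hint] at h

/-- [folklore] **Jensen by the tangent line.**  A bounded CENTRED variable has `1 ≤ E_ν e^{sS}` for every real `s`
(`1 + sS ≤ e^{sS}` integrated; `T4PathwiseCoupling` uses the same tangent for the lower half of (AZ)). -/
theorem one_le_mgf_of_centred [IsProbabilityMeasure ν] (hSm : AEMeasurable S ν) (hSb : ∀ᵐ ω ∂ν, |S ω| ≤ b)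
    (hSc : ∫ ω, S ω ∂ν = 0) (s : ℝ) : 1 ≤ mgf S ν s := by
  have hSi : Integrable S ν :=
    Integrable.of_bound hSm.aestronglyMeasurable b (hSb.mono fun ω h => by simpa [Real.norm_eq_abs] using h)
  have hexp : Integrable (fun ω => Real.exp (s * S ω)) ν :=
    integrable_exp_mul_of_mem_Icc hSm (hSb.mono fun _ h => Set.mem_Icc.mpr (abs_le.mp h))
  have hlin : Integrable (fun ω => s * S ω + 1) ν := (hSi.const_mul s).add (integrable_const _)
  calc (1 : ℝ) = ∫ ω, (s * S ω + 1) ∂ν := by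
        rw [integral_add (hSi.const_mul s) (integrable_const _), integral_const_mul, hSc, integral_const]
        simp
    _ ≤ ∫ ω, Real.exp (s * S ω) ∂ν := integral_mono hlin hexp fun ω => Real.add_one_le_exp _
    _ = mgf S ν s := rfl

/-- [folklore] **Pointwise sector bound.**  `|x| ≤ b`, `‖t‖·b ≤ 1` ⇒ `Re e^{tx} = e^{(Re t)x}cos((Im t)x) ≥ e^{-1}cos 1`. -/
theorem re_cexp_mul_ofReal_ge {t : ℂ} {x : ℝ} (hx : |x| ≤ b) (htb : ‖t‖ * b ≤ 1) :
    Real.exp (-1) * Real.cos 1 ≤ (Complex.exp (t * x)).re := by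
  rw [Complex.exp_re]
  have hre : (t * (x : ℂ)).re = t.re * x := by simp [Complex.mul_re]
  have him : (t * (x : ℂ)).im = t.im * x := by simp [Complex.mul_im]
  rw [hre, him]
  have h1 : |t.re * x| ≤ 1 := by
    rw [abs_mul]
    calc |t.re| * |x| ≤ ‖t‖ * b := mul_le_mul (Complex.abs_re_le_norm t) hx (abs_nonneg x) (norm_nonneg t)
      _ ≤ 1 := htb
  have h2 : |t.im * x| ≤ 1 := by
    rw [abs_mul]
    calc |t.im| * |x| ≤ ‖t‖ * b := mul_le_mul (Complex.abs_im_le_norm t) hx (abs_nonneg x) (norm_nonneg t)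
      _ ≤ 1 := htb
  have hexp : Real.exp (-1) ≤ Real.exp (t.re * x) := Real.exp_le_exp.mpr (abs_le.mp h1).1
  have hcos : Real.cos 1 ≤ Real.cos (t.im * x) := by
    rw [← Real.cos_abs (t.im * x)]
    exact Real.cos_le_cos_of_nonneg_of_le_pi (abs_nonneg _) (by linarith [Real.pi_gt_three]) h2
  have hcos1 : 0 ≤ Real.cos 1 :=
    Real.cos_nonneg_of_mem_Icc ⟨by linarith [Real.pi_gt_three], by linarith [Real.pi_gt_three]⟩
  exact mul_le_mul hexp hcos hcos1 (Real.exp_pos _).le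

/-- [folklore] The sector constant is positive: `0 < e^{-1}·cos 1` (`1 < π/2`). -/
theorem exp_neg_one_mul_cos_one_pos : 0 < Real.exp (-1) * Real.cos 1 :=
  mul_pos (Real.exp_pos _)
    (Real.cos_pos_of_mem_Ioo ⟨by linarith [Real.pi_gt_three], by linarith [Real.pi_gt_three]⟩)

/-- [folklore] **Sector lemma.**  `|S| ≤ b` a.e. under a probability measure and `‖t‖·b ≤ 1` ⇒
`e^{-1}cos 1 ≤ Re E_ν[e^{tS}]`; in particular `Z(t)` lies in the open right half plane. -/
theorem re_complexMGF_ge [IsProbabilityMeasure ν] (hSm : AEMeasurable S ν) (hSb : ∀ᵐ ω ∂ν, |S ω| ≤ b)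
    {t : ℂ} (htb : ‖t‖ * b ≤ 1) : Real.exp (-1) * Real.cos 1 ≤ (complexMGF S ν t).re := by
  have hint : Integrable (fun ω => Complex.exp (t * S ω)) ν :=
    integrable_cexp_mul_of_re_mem_interior_integrableExpSet (re_mem_interior_integrableExpSet hSm hSb t)
  have hre : (complexMGF S ν t).re = ∫ ω, (Complex.exp (t * S ω)).re ∂ν := by
    rw [complexMGF]
    have h := integral_re hint
    simpa using h.symm
  rw [hre]
  have hconst : ∫ _ω, Real.exp (-1) * Real.cos 1 ∂ν = Real.exp (-1) * Real.cos 1 := by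
    simp [integral_const]
  rw [← hconst]
  refine integral_mono_ae (integrable_const _) ?_ ?_
  · simpa using hint.re
  · filter_upwards [hSb] with ω hω
    exact re_cexp_mul_ofReal_ge hω htb

/-- [folklore] `Z(t) ∈ slitPlane` (indeed `Re Z(t) > 0`) for `‖t‖·b ≤ 1`. -/
theorem complexMGF_mem_slitPlane [IsProbabilityMeasure ν] (hSm : AEMeasurable S ν)
    (hSb : ∀ᵐ ω ∂ν, |S ω| ≤ b) {t : ℂ} (htb : ‖t‖ * b ≤ 1) : complexMGF S ν t ∈ Complex.slitPlane :=
  Complex.mem_slitPlane_iff.mpr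
    (Or.inl (exp_neg_one_mul_cos_one_pos.trans_le (re_complexMGF_ge hSm hSb htb)))

/-- [folklore] `Z(t) ≠ 0` for `‖t‖·b ≤ 1`. -/
theorem complexMGF_ne_zero [IsProbabilityMeasure ν] (hSm : AEMeasurable S ν)
    (hSb : ∀ᵐ ω ∂ν, |S ω| ≤ b) {t : ℂ} (htb : ‖t‖ * b ≤ 1) : complexMGF S ν t ≠ 0 :=
  Complex.slitPlane_ne_zero (complexMGF_mem_slitPlane hSm hSb htb)

end BoundedMGF

/-! ## §3  The complex cumulant function: holomorphy on the disc and the quadratic bound -/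

section LogMGF

variable {Ω : Type*} {mΩ : MeasurableSpace Ω} {ν : Measure Ω} [IsProbabilityMeasure ν] {S : Ω → ℝ} {b : ℝ}

/-- [folklore] Arithmetic: `‖t‖ < b⁻¹`, `b > 0` ⇒ `‖t‖·b ≤ 1`. -/
lemma norm_mul_le_one_of_lt_inv (hb : 0 < b) {t : ℂ} (ht : ‖t‖ < b⁻¹) : ‖t‖ * b ≤ 1 :=
  calc ‖t‖ * b ≤ b⁻¹ * b := mul_le_mul_of_nonneg_right ht.le hb.le
    _ = 1 := inv_mul_cancel₀ hb.ne'

/-- [folklore] `t ↦ log E_ν[e^{tS}]` is HOLOMORPHIC on the disc `‖t‖ < b⁻¹` (`|S| ≤ b` a.e., `b > 0`). -/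
theorem differentiableOn_log_complexMGF (hSm : AEMeasurable S ν) (hb : 0 < b) (hSb : ∀ᵐ ω ∂ν, |S ω| ≤ b) :
    DifferentiableOn ℂ (fun t => Complex.log (complexMGF S ν t)) (ball 0 b⁻¹) := fun t ht =>
  ((differentiable_complexMGF_of_bounded hSm hSb t).clog
    (complexMGF_mem_slitPlane hSm hSb (norm_mul_le_one_of_lt_inv hb (mem_ball_zero_iff.mp ht)))).differentiableWithinAt

/-- [folklore] **Real part of the cumulant function from the real sub-Gaussian bound.**  `|S| ≤ b` a.e.,
`E_ν e^{sS} ≤ e^{B s²}` for real `|s| < b⁻¹` (`B ≥ 0`) ⇒ `Re log E_ν[e^{tS}] = log ‖E_ν e^{tS}‖ ≤ B‖t‖²` on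
`‖t‖ < b⁻¹` (since `‖E_ν e^{tS}‖ ≤ E_ν e^{(Re t)S}`). -/
theorem re_log_complexMGF_le (hSm : AEMeasurable S ν) (hb : 0 < b) (hSb : ∀ᵐ ω ∂ν, |S ω| ≤ b) {B : ℝ}
    (hB : 0 ≤ B) (hmgf : ∀ s : ℝ, |s| < b⁻¹ → mgf S ν s ≤ Real.exp (B * s ^ 2)) {t : ℂ} (ht : ‖t‖ < b⁻¹) :
    (Complex.log (complexMGF S ν t)).re ≤ B * ‖t‖ ^ 2 := by
  rw [Complex.log_re]
  have hpos : 0 < ‖complexMGF S ν t‖ :=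
    norm_pos_iff.mpr (complexMGF_ne_zero hSm hSb (norm_mul_le_one_of_lt_inv hb ht))
  have hre : |t.re| < b⁻¹ := (Complex.abs_re_le_norm t).trans_lt ht
  calc Real.log ‖complexMGF S ν t‖ ≤ Real.log (Real.exp (B * t.re ^ 2)) :=
        Real.log_le_log hpos (norm_complexMGF_le_mgf.trans (hmgf t.re hre))
    _ = B * t.re ^ 2 := Real.log_exp _
    _ ≤ B * ‖t‖ ^ 2 := by
        have h : t.re ^ 2 ≤ ‖t‖ ^ 2 := by
          rw [← sq_abs]
          exact pow_le_pow_left₀ (abs_nonneg _) (Complex.abs_re_le_norm t) 2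
        exact mul_le_mul_of_nonneg_left h hB

/-- [folklore] The sub-Gaussian constant of a CENTRED variable is automatically `≥ 0`: `1 ≤ E_ν e^{sS} ≤ e^{Bs²}`
at `s = b⁻¹/2 ≠ 0`. -/
theorem subGaussianConst_nonneg (hSm : AEMeasurable S ν) (hb : 0 < b) (hSb : ∀ᵐ ω ∂ν, |S ω| ≤ b)
    (hSc : ∫ ω, S ω ∂ν = 0) {B : ℝ} (hmgf : ∀ s : ℝ, |s| < b⁻¹ → mgf S ν s ≤ Real.exp (B * s ^ 2)) :
    0 ≤ B := by
  have hR : 0 < b⁻¹ := inv_pos.mpr hb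
  have hs : |b⁻¹ / 2| < b⁻¹ := by rw [abs_of_pos (by positivity)]; linarith
  have h : 1 ≤ Real.exp (B * (b⁻¹ / 2) ^ 2) := (one_le_mgf_of_centred hSm hSb hSc _).trans (hmgf _ hs)
  rw [Real.one_le_exp_iff] at h
  by_contra hB
  have : B * (b⁻¹ / 2) ^ 2 < 0 := mul_neg_of_neg_of_pos (not_le.mp hB) (by positivity)
  linarith

/-- [folklore] **MAIN THEOREM — the complex cumulant function of a bounded centred sub-Gaussian variable is
QUADRATICALLY SMALL on a disc of radius `1/(2‖S‖_∞)`.**  `ν` a probability measure, `|S| ≤ b` a.e. (`b > 0`),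
`E_ν S = 0`, and the REAL bound `E_ν e^{sS} ≤ e^{B s²}` for `|s| < b⁻¹` (then `B ≥ 0` automatically,
`subGaussianConst_nonneg`) ⇒ for complex `‖t‖ < b⁻¹/2`:
`‖log E_ν[e^{tS}]‖ ≤ 8·B·‖t‖²`.  Proof: §2 (entire, non-vanishing, `log Z(0) = 0`, `(log Z)'(0) = 0`),
`re_log_complexMGF_le` (`Re log Z ≤ B b⁻²` on the disc), the quadratic Borel–Carathéodory inequality of §1 with
`A = (B + δ)b⁻²`, and `δ ↓ 0`. -/
theorem norm_log_complexMGF_le (hSm : AEMeasurable S ν) (hb : 0 < b) (hSb : ∀ᵐ ω ∂ν, |S ω| ≤ b)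
    (hSc : ∫ ω, S ω ∂ν = 0) {B : ℝ}
    (hmgf : ∀ s : ℝ, |s| < b⁻¹ → mgf S ν s ≤ Real.exp (B * s ^ 2)) {t : ℂ} (ht : ‖t‖ < b⁻¹ / 2) :
    ‖Complex.log (complexMGF S ν t)‖ ≤ 8 * B * ‖t‖ ^ 2 := by
  have hR : 0 < b⁻¹ := inv_pos.mpr hb
  have hB : 0 ≤ B := subGaussianConst_nonneg hSm hb hSb hSc hmgf
  have hd : DifferentiableOn ℂ (fun t => Complex.log (complexMGF S ν t)) (ball 0 b⁻¹) :=
    differentiableOn_log_complexMGF hSm hb hSb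
  have hG0 : (fun t => Complex.log (complexMGF S ν t)) 0 = 0 := by
    simp [complexMGF_zero_eq_one]
  have hG1 : HasDerivAt (fun t => Complex.log (complexMGF S ν t)) 0 0 := by
    have hZ := hasDerivAt_complexMGF_zero_of_centred hSm hSb hSc
    have hslit : complexMGF S ν 0 ∈ Complex.slitPlane := by
      rw [complexMGF_zero_eq_one]; exact Complex.one_mem_slitPlane
    simpa using hZ.clog hslit
  refine le_of_forall_pos_le_add fun ε hε => ?_
  obtain ⟨δ, hδpos, hδε⟩ : ∃ δ : ℝ, 0 < δ ∧ 8 * ‖t‖ ^ 2 * δ ≤ ε := by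
    refine ⟨ε / (8 * ‖t‖ ^ 2 + 1), div_pos hε (by positivity), ?_⟩
    rw [mul_div_assoc', div_le_iff₀ (by positivity)]
    nlinarith [sq_nonneg ‖t‖, hε.le]
  have hApos : 0 < (B + δ) * b⁻¹ ^ 2 := by positivity
  have hre : MapsTo (fun t => Complex.log (complexMGF S ν t)) (ball 0 b⁻¹) {w | w.re ≤ (B + δ) * b⁻¹ ^ 2} := by
    intro w hw
    have hw' : ‖w‖ < b⁻¹ := mem_ball_zero_iff.mp hw
    have h2 : ‖w‖ ^ 2 ≤ b⁻¹ ^ 2 := pow_le_pow_left₀ (norm_nonneg _) hw'.le 2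
    show (Complex.log (complexMGF S ν w)).re ≤ (B + δ) * b⁻¹ ^ 2
    calc (Complex.log (complexMGF S ν w)).re ≤ B * ‖w‖ ^ 2 := re_log_complexMGF_le hSm hb hSb hB hmgf hw'
      _ ≤ B * b⁻¹ ^ 2 := mul_le_mul_of_nonneg_left h2 hB
      _ ≤ (B + δ) * b⁻¹ ^ 2 := by nlinarith [sq_nonneg b⁻¹, hδpos.le]
  have hmain : ‖Complex.log (complexMGF S ν t)‖ ≤ 8 * ((B + δ) * b⁻¹ ^ 2) * ‖t‖ ^ 2 / b⁻¹ ^ 2 :=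
    norm_le_of_mapsTo_re_le (G := fun t => Complex.log (complexMGF S ν t)) hR hApos hd hre hG0 hG1 ht
  have hb2 : b⁻¹ ^ 2 ≠ 0 := pow_ne_zero 2 hR.ne'
  have heq : 8 * ((B + δ) * b⁻¹ ^ 2) * ‖t‖ ^ 2 / b⁻¹ ^ 2 = 8 * B * ‖t‖ ^ 2 + 8 * ‖t‖ ^ 2 * δ := by
    field_simp
  linarith

/-- [folklore] **Exponential form.**  Under the hypotheses of `norm_log_complexMGF_le`:
`E_ν[e^{tS}] = e^{Ψ}` with `‖Ψ‖ ≤ 8B‖t‖²` (`Ψ = log E_ν[e^{tS}]`), for complex `‖t‖ < b⁻¹/2`. -/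
theorem complexMGF_eq_exp (hSm : AEMeasurable S ν) (hb : 0 < b) (hSb : ∀ᵐ ω ∂ν, |S ω| ≤ b)
    (hSc : ∫ ω, S ω ∂ν = 0) {B : ℝ}
    (hmgf : ∀ s : ℝ, |s| < b⁻¹ → mgf S ν s ≤ Real.exp (B * s ^ 2)) {t : ℂ} (ht : ‖t‖ < b⁻¹ / 2) :
    ∃ Ψ : ℂ, ‖Ψ‖ ≤ 8 * B * ‖t‖ ^ 2 ∧ complexMGF S ν t = Complex.exp Ψ := by
  have hR : 0 < b⁻¹ := inv_pos.mpr hb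
  refine ⟨Complex.log (complexMGF S ν t), norm_log_complexMGF_le hSm hb hSb hSc hmgf ht, ?_⟩
  exact (Complex.exp_log (complexMGF_ne_zero hSm hSb (norm_mul_le_one_of_lt_inv hb (by linarith)))).symm

/-- [folklore] **The dressing-variable form (what `T4PathwiseCoupling` §3 feeds, fibrewise).**  `ν` a probability
measure (a fibre of the endpoint), `f` with `|f| ≤ R` a.e. (`R > 0`; `R = ‖W‖_∞` for the loop variable), and the REAL
sandwich upper bound ABOUT THE MEAN `E_ν e^{sf} ≤ e^{s·E_ν f}·e^{V s²}` for `|s| < 1/(2R)` ((AZ) gives it for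
all real `s` with `V = ½Σσ_i²`, the variance form for `|s|·2R ≤ 1` with `V = Σ v_i`) ⇒ for COMPLEX `‖t‖ < 1/(4R)`:
`E_ν[e^{tf}] = e^{t·E_ν f} · e^{Ψ}`, `‖Ψ‖ ≤ 8·V·‖t‖²`.  The radius `1/(4R)` and the constant depend on NOTHING but
`R` and the ℓ² budget `V`. -/
theorem complexMGF_dressing_eq_exp {f : Ω → ℝ} (hfm : AEMeasurable f ν) {R : ℝ} (hR : 0 < R)
    (hfR : ∀ᵐ ω ∂ν, |f ω| ≤ R) {V : ℝ}
    (hmgf : ∀ s : ℝ, |s| < (2 * R)⁻¹ →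
      mgf f ν s ≤ Real.exp (s * ∫ ω, f ω ∂ν) * Real.exp (V * s ^ 2))
    {t : ℂ} (ht : ‖t‖ < (2 * R)⁻¹ / 2) :
    ∃ Ψ : ℂ, ‖Ψ‖ ≤ 8 * V * ‖t‖ ^ 2 ∧
      complexMGF f ν t = Complex.exp (t * (∫ ω, f ω ∂ν : ℝ)) * Complex.exp Ψ := by
  set m : ℝ := ∫ ω, f ω ∂ν with hm
  have hfi : Integrable f ν :=
    Integrable.of_bound hfm.aestronglyMeasurable R (hfR.mono fun ω h => by simpa [Real.norm_eq_abs] using h)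
  have hmR : |m| ≤ R := by
    have h := norm_integral_le_of_norm_le_const (μ := ν) (f := f) (C := R)
      (hfR.mono fun ω h => by simpa [Real.norm_eq_abs] using h)
    simpa [Real.norm_eq_abs, hm] using h
  -- the centred variable
  have hSm : AEMeasurable (fun ω => f ω - m) ν := hfm.sub aemeasurable_const
  have hSb : ∀ᵐ ω ∂ν, |f ω - m| ≤ 2 * R := by
    filter_upwards [hfR] with ω hω
    calc |f ω - m| ≤ |f ω| + |m| := abs_sub _ _
      _ ≤ R + R := add_le_add hω hmR
      _ = 2 * R := by ring
  have hSc : ∫ ω, (f ω - m) ∂ν = 0 := by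
    rw [integral_sub hfi (integrable_const m), integral_const]
    simp [hm]
  have h2R : 0 < 2 * R := by positivity
  have hmgfS : ∀ s : ℝ, |s| < (2 * R)⁻¹ → mgf (fun ω => f ω - m) ν s ≤ Real.exp (V * s ^ 2) := by
    intro s hs
    have hfun : (fun ω => f ω - m) = fun ω => f ω + (-m) := by funext ω; ring
    rw [hfun, mgf_add_const]
    calc mgf f ν s * Real.exp (s * (-m)) ≤ Real.exp (s * m) * Real.exp (V * s ^ 2) * Real.exp (s * (-m)) :=
          mul_le_mul_of_nonneg_right (hmgf s hs) (Real.exp_pos _).le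
      _ = Real.exp (V * s ^ 2) := by
          rw [← Real.exp_add, ← Real.exp_add]
          congr 1
          ring
  obtain ⟨Ψ, hΨ, hZ⟩ := complexMGF_eq_exp hSm h2R hSb hSc hmgfS ht
  refine ⟨Ψ, hΨ, ?_⟩
  have hsplit : complexMGF f ν t = Complex.exp (t * (m : ℂ)) * complexMGF (fun ω => f ω - m) ν t := by
    rw [complexMGF, complexMGF, ← integral_const_mul]
    congr 1
    funext ω
    rw [← Complex.exp_add]
    congr 1
    push_cast
    ring
  rw [hsplit, hZ]

end LogMGF


/-! ## §4  From the a.e. conditional sandwiches of `T4PathwiseCoupling` §3 to the fibre measures: density in the real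
parameter, and the bridge by `condExpKernel` on a standard Borel path space -/

section Density

/-- [folklore] An inequality between continuous real functions that holds at the RATIONAL points of an open set holds on
the whole open set (the rationals are dense; `{g ≤ h}` is closed). -/
theorem le_on_open_of_rat {g h : ℝ → ℝ} (hg : Continuous g) (hh : Continuous h) {U : Set ℝ} (hU : IsOpen U)
    (hq : ∀ q : ℚ, (q : ℝ) ∈ U → g q ≤ h q) {s : ℝ} (hs : s ∈ U) : g s ≤ h s := by
  have hC : IsClosed {x : ℝ | g x ≤ h x} := isClosed_le hg hh
  have hsub : U ∩ Set.range ((↑) : ℚ → ℝ) ⊆ {x : ℝ | g x ≤ h x} := by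
    rintro x ⟨hxU, ⟨q, rfl⟩⟩
    exact hq q hxU
  have h1 : U ⊆ closure (U ∩ Set.range ((↑) : ℚ → ℝ)) :=
    (Rat.denseRange_cast (𝕜 := ℝ)).open_subset_closure_inter hU
  exact hC.closure_subset_iff.mpr hsub (h1 hs)

variable {Ω : Type*} {mΩ : MeasurableSpace Ω} {ν : Measure Ω} [IsProbabilityMeasure ν]

/-- [folklore] `complexMGF_dressing_eq_exp` with the real hypothesis required at RATIONAL `s` only (the form in which a
family of a.e. statements indexed by `s` can be made simultaneous): `s ↦ E_ν e^{sf}` is continuous for bounded `f`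
(`ProbabilityTheory.continuous_mgf`), so the bound extends from `ℚ` to the open interval `|s| < 1/(2R)`. -/
theorem complexMGF_dressing_eq_exp_of_rat {f : Ω → ℝ} (hfm : AEMeasurable f ν) {R : ℝ} (hR : 0 < R)
    (hfR : ∀ᵐ ω ∂ν, |f ω| ≤ R) {V : ℝ}
    (hmgf : ∀ q : ℚ, |(q : ℝ)| < (2 * R)⁻¹ →
      mgf f ν q ≤ Real.exp (q * ∫ ω, f ω ∂ν) * Real.exp (V * (q : ℝ) ^ 2))
    {t : ℂ} (ht : ‖t‖ < (2 * R)⁻¹ / 2) :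
    ∃ Ψ : ℂ, ‖Ψ‖ ≤ 8 * V * ‖t‖ ^ 2 ∧
      complexMGF f ν t = Complex.exp (t * (∫ ω, f ω ∂ν : ℝ)) * Complex.exp Ψ := by
  refine complexMGF_dressing_eq_exp hfm hR hfR (fun s hs => ?_) ht
  have hcont : Continuous (mgf f ν) :=
    continuous_mgf fun u => integrable_exp_mul_of_mem_Icc hfm (hfR.mono fun _ h => Set.mem_Icc.mpr (abs_le.mp h))
  have hh : Continuous fun s : ℝ => Real.exp (s * ∫ ω, f ω ∂ν) * Real.exp (V * s ^ 2) :=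
    (Real.continuous_exp.comp (continuous_id.mul continuous_const)).mul
      (Real.continuous_exp.comp (continuous_const.mul (continuous_id.pow 2)))
  have hU : IsOpen {s : ℝ | |s| < (2 * R)⁻¹} := isOpen_lt continuous_abs continuous_const
  exact le_on_open_of_rat hcont hh hU (fun q hq => hmgf q hq) hs

end Density

section KernelBridge

open Literature.MathematicalPhysics.QuantumFieldTheory.Balaban1983to89.T4PathwiseCoupling
  (IncrementBound IncrementVarBound condExp_exp_dressing_sandwich condExp_exp_dressing_sandwich_of_condVar)

-- NB the sub-σ-algebra `m` is declared BEFORE the ambient `mΩ`, so that `mΩ` is the instance found first (as in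
-- `Mathlib.Probability.Kernel.Condexp`).
variable {Ω : Type*} {m : MeasurableSpace Ω} {mΩ : MeasurableSpace Ω} [StandardBorelSpace Ω] {μ : Measure Ω}
  [IsFiniteMeasure μ]

/-- [folklore] On a standard Borel space the conditional moment generating function is a.e. the moment generating
function under the FIBRE MEASURE `condExpKernel μ m ω` (a probability measure): for each real `s`,
`μ[e^{sf} ∣ m] = E_{κ_ω} e^{sf}` a.e. (`ProbabilityTheory.condExp_ae_eq_integral_condExpKernel`). -/
theorem condExp_exp_mul_ae_eq_mgf_condExpKernel (hm : m ≤ mΩ) {f : Ω → ℝ} (hfm : Measurable f) {R : ℝ}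
    (hfR : ∀ ω, |f ω| ≤ R) (s : ℝ) :
    μ[fun ω => Real.exp (s * f ω) | m] =ᵐ[μ] fun ω => mgf f (condExpKernel μ m ω) s := by
  have hint : Integrable (fun ω => Real.exp (s * f ω)) μ :=
    integrable_exp_mul_of_mem_Icc hfm.aemeasurable
      (ae_of_all μ fun ω => Set.mem_Icc.mpr (abs_le.mp (hfR ω)))
  exact condExp_ae_eq_integral_condExpKernel hm hint

/-- [folklore] The same for the COMPLEX parameter: for each `t : ℂ`, `μ[e^{tf} ∣ m] = E_{κ_ω} e^{tf} = complexMGF f κ_ω t`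
a.e. — the dressed/undressed density ratio of `T4PathwiseCoupling` §4 at complex dressing parameter, fibrewise. -/
theorem condExp_cexp_mul_ae_eq_complexMGF_condExpKernel (hm : m ≤ mΩ) {f : Ω → ℝ} (hfm : Measurable f) {R : ℝ}
    (hfR : ∀ ω, |f ω| ≤ R) (t : ℂ) :
    μ[fun ω => Complex.exp (t * f ω) | m] =ᵐ[μ] fun ω => complexMGF f (condExpKernel μ m ω) t := by
  have hint : Integrable (fun ω => Complex.exp (t * f ω)) μ :=
    integrable_cexp_mul_of_re_mem_interior_integrableExpSet
      (re_mem_interior_integrableExpSet hfm.aemeasurable (ae_of_all μ hfR) t)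
  exact condExp_ae_eq_integral_condExpKernel hm hint

/-- [folklore] The conditional mean is a.e. the fibre mean: `μ[f ∣ m] = E_{κ_ω} f`. -/
theorem condExp_ae_eq_integral_condExpKernel_of_bounded (hm : m ≤ mΩ) {f : Ω → ℝ} (hfm : Measurable f) {R : ℝ}
    (hfR : ∀ ω, |f ω| ≤ R) : μ[f | m] =ᵐ[μ] fun ω => ∫ y, f y ∂(condExpKernel μ m ω) :=
  condExp_ae_eq_integral_condExpKernel hm
    (Integrable.of_bound hfm.aestronglyMeasurable R
      (ae_of_all μ fun ω => by simpa [Real.norm_eq_abs] using hfR ω))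

/-- [folklore] **THE BRIDGE.**  `Ω` standard Borel, `μ` finite, `m ≤ mΩ`, `f` measurable with `|f| ≤ R` (`R > 0`), and the
REAL a.e. sandwich upper bound `μ[e^{sf} ∣ m] ≤ e^{s·μ[f∣m]}·e^{Vs²}` for every real `|s| < 1/(2R)` (the shape of
`T4PathwiseCoupling.condExp_exp_dressing_sandwich(_of_condVar)`) ⇒ for `μ`-a.e. `ω`, SIMULTANEOUSLY for all complex
`‖t‖ < 1/(4R)`: `E_{κ_ω}[e^{tf}] = e^{t·E_{κ_ω} f}·e^{Ψ}` with `‖Ψ‖ ≤ 8V‖t‖²`, `κ = condExpKernel μ m`.  Proof: the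
hypothesis at rational `s` is a countable family of a.e. statements, read on the fibres by the three lemmas above;
`complexMGF_dressing_eq_exp_of_rat` fibrewise. -/
theorem ae_condExpKernel_dressing_eq_exp (hm : m ≤ mΩ) {f : Ω → ℝ} (hfm : Measurable f) {R : ℝ} (hR : 0 < R)
    (hfR : ∀ ω, |f ω| ≤ R) {V : ℝ}
    (hsand : ∀ s : ℝ, |s| < (2 * R)⁻¹ →
      μ[fun ω => Real.exp (s * f ω) | m] ≤ᵐ[μ] fun ω => Real.exp (s * μ[f | m] ω) * Real.exp (V * s ^ 2)) :
    ∀ᵐ ω ∂μ, ∀ t : ℂ, ‖t‖ < (2 * R)⁻¹ / 2 →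
      ∃ Ψ : ℂ, ‖Ψ‖ ≤ 8 * V * ‖t‖ ^ 2 ∧
        complexMGF f (condExpKernel μ m ω) t =
          Complex.exp (t * (∫ y, f y ∂(condExpKernel μ m ω) : ℝ)) * Complex.exp Ψ := by
  have hmean := condExp_ae_eq_integral_condExpKernel_of_bounded (μ := μ) hm hfm hfR
  have hrat : ∀ᵐ ω ∂μ, ∀ q : ℚ, |(q : ℝ)| < (2 * R)⁻¹ →
      mgf f (condExpKernel μ m ω) q ≤
        Real.exp (q * ∫ y, f y ∂(condExpKernel μ m ω)) * Real.exp (V * (q : ℝ) ^ 2) := by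
    rw [ae_all_iff]
    intro q
    by_cases hq : |(q : ℝ)| < (2 * R)⁻¹
    · filter_upwards [hsand (q : ℝ) hq, condExp_exp_mul_ae_eq_mgf_condExpKernel (μ := μ) hm hfm hfR (q : ℝ),
        hmean] with ω h1 h2 h3
      intro _
      rw [← h2, ← h3]
      exact h1
    · exact ae_of_all μ fun ω h => absurd h hq
  filter_upwards [hrat] with ω hω t ht
  exact complexMGF_dressing_eq_exp_of_rat hfm.aemeasurable hR (ae_of_all _ hfR) hω ht

variable {F : ℕ → MeasurableSpace Ω}

/-- [folklore] **END-TO-END, Hoeffding form: `IncrementBound` ⇒ the COMPLEX dressing factorisation on the fibres of the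
endpoint.**  `F` antitone with `F j ≤ mΩ`, `f` `F 0`-measurable with `|f| ≤ R` (`R > 0`), `IncrementBound μ F f n σ`
(`T4PathwiseCoupling` (A1)+(A3) shape) ⇒ for `μ`-a.e. `ω` and all complex `‖t‖ < 1/(4R)`:
`E_{κ_ω}[e^{tf}] = e^{t·E_{κ_ω} f}·e^{Ψ}`, `‖Ψ‖ ≤ 4‖t‖²·Σ_{i<n}σ_i²`, `κ = condExpKernel μ (F n)` — by
`T4PathwiseCoupling.condExp_exp_dressing_sandwich` (real `s`, `V = ½Σσ²`) and THE BRIDGE.  With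
`condExp_cexp_mul_ae_eq_complexMGF_condExpKernel`: `μ[e^{tf} ∣ F n] = e^{t·μ[f∣F n]}·e^{Ψ_t}` a.e. for each complex `t` in
the disc, the (A4) form of (AZ). -/
theorem ae_condExpKernel_dressing_eq_exp_of_incrementBound (hF : Antitone F) (hFle : ∀ j, F j ≤ mΩ)
    {f : Ω → ℝ} (hf0 : StronglyMeasurable[F 0] f) {R : ℝ} (hR : 0 < R) (hfR : ∀ ω, |f ω| ≤ R) (n : ℕ)
    {σ : ℕ → ℝ} (hσ : IncrementBound μ F f n σ) :
    ∀ᵐ ω ∂μ, ∀ t : ℂ, ‖t‖ < (2 * R)⁻¹ / 2 →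
      ∃ Ψ : ℂ, ‖Ψ‖ ≤ 4 * ‖t‖ ^ 2 * (∑ i ∈ Finset.range n, σ i ^ 2) ∧
        complexMGF f (condExpKernel μ (F n) ω) t =
          Complex.exp (t * (∫ y, f y ∂(condExpKernel μ (F n) ω) : ℝ)) * Complex.exp Ψ := by
  have hfm : Measurable f := (hf0.mono (hFle 0)).measurable
  have hsand : ∀ s : ℝ, |s| < (2 * R)⁻¹ →
      μ[fun ω => Real.exp (s * f ω) | F n] ≤ᵐ[μ]
        fun ω => Real.exp (s * μ[f | F n] ω) * Real.exp ((∑ i ∈ Finset.range n, σ i ^ 2) / 2 * s ^ 2) := by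
    intro s _
    refine (condExp_exp_dressing_sandwich (μ := μ) hF hFle hf0 hfR n hσ s).2.trans_eq ?_
    exact Filter.Eventually.of_forall fun ω => by
      rw [show s ^ 2 * (∑ i ∈ Finset.range n, σ i ^ 2) / 2 = (∑ i ∈ Finset.range n, σ i ^ 2) / 2 * s ^ 2 by ring]
  filter_upwards [ae_condExpKernel_dressing_eq_exp (hFle n) hfm hR hfR hsand] with ω hω t ht
  obtain ⟨Ψ, hΨ, hZ⟩ := hω t ht
  exact ⟨Ψ, hΨ.trans_eq (by ring), hZ⟩

/-- [folklore] **END-TO-END, variance form: `IncrementVarBound` ⇒ the COMPLEX dressing factorisation.**  As above with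
`IncrementVarBound μ F f n v` (conditional variances; `T4PathwiseCoupling.condExp_exp_dressing_sandwich_of_condVar`, whose
real range `|s|·2R ≤ 1` contains the range `|s| < 1/(2R)` used here): for `μ`-a.e. `ω` and complex `‖t‖ < 1/(4R)`,
`E_{κ_ω}[e^{tf}] = e^{t·E_{κ_ω} f}·e^{Ψ}`, `‖Ψ‖ ≤ 8‖t‖²·Σ_{i<n} v_i`.  NO sup-oscillation input: range `2R` + conditional
variances, exactly as on the real axis. -/
theorem ae_condExpKernel_dressing_eq_exp_of_incrementVarBound (hF : Antitone F) (hFle : ∀ j, F j ≤ mΩ)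
    {f : Ω → ℝ} (hf0 : StronglyMeasurable[F 0] f) {R : ℝ} (hR : 0 < R) (hfR : ∀ ω, |f ω| ≤ R) (n : ℕ)
    {v : ℕ → ℝ} (hv : IncrementVarBound μ F f n v) :
    ∀ᵐ ω ∂μ, ∀ t : ℂ, ‖t‖ < (2 * R)⁻¹ / 2 →
      ∃ Ψ : ℂ, ‖Ψ‖ ≤ 8 * ‖t‖ ^ 2 * (∑ i ∈ Finset.range n, v i) ∧
        complexMGF f (condExpKernel μ (F n) ω) t =
          Complex.exp (t * (∫ y, f y ∂(condExpKernel μ (F n) ω) : ℝ)) * Complex.exp Ψ := by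
  have hfm : Measurable f := (hf0.mono (hFle 0)).measurable
  have h2R : 0 < 2 * R := by positivity
  have hsand : ∀ s : ℝ, |s| < (2 * R)⁻¹ →
      μ[fun ω => Real.exp (s * f ω) | F n] ≤ᵐ[μ]
        fun ω => Real.exp (s * μ[f | F n] ω) * Real.exp ((∑ i ∈ Finset.range n, v i) * s ^ 2) := by
    intro s hs
    have hs' : |s| * (2 * R) ≤ 1 :=
      calc |s| * (2 * R) ≤ (2 * R)⁻¹ * (2 * R) := mul_le_mul_of_nonneg_right hs.le h2R.le
        _ = 1 := inv_mul_cancel₀ h2R.ne'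
    refine (condExp_exp_dressing_sandwich_of_condVar (μ := μ) hF hFle hf0 hfR n hv hs').2.trans_eq ?_
    exact Filter.Eventually.of_forall fun ω => by rw [mul_comm (s ^ 2)]
  filter_upwards [ae_condExpKernel_dressing_eq_exp (hFle n) hfm hR hfR hsand] with ω hω t ht
  obtain ⟨Ψ, hΨ, hZ⟩ := hω t ht
  exact ⟨Ψ, hΨ.trans_eq (by ring), hZ⟩

/-- [folklore] **THE (A4) FORM OF (AZ), Hoeffding budget.**  Under `IncrementBound μ F f n σ`, for each complex
`‖t‖ < 1/(4R)`: `μ[e^{tf} ∣ F n] = e^{t·μ[f∣F n]}·e^{Ψ}` a.e. with `‖Ψ‖ ≤ 4‖t‖²·Σ_{i<n}σ_i²` — DRESSED = UNDRESSED ×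
`exp(t·h + Ψ_t)` at complex dressing parameter, the fluctuation channel quadratically small with the ℓ² budget. -/
theorem ae_condExp_cexp_dressing_of_incrementBound (hF : Antitone F) (hFle : ∀ j, F j ≤ mΩ)
    {f : Ω → ℝ} (hf0 : StronglyMeasurable[F 0] f) {R : ℝ} (hR : 0 < R) (hfR : ∀ ω, |f ω| ≤ R) (n : ℕ)
    {σ : ℕ → ℝ} (hσ : IncrementBound μ F f n σ) {t : ℂ} (ht : ‖t‖ < (2 * R)⁻¹ / 2) :
    ∀ᵐ ω ∂μ, ∃ Ψ : ℂ, ‖Ψ‖ ≤ 4 * ‖t‖ ^ 2 * (∑ i ∈ Finset.range n, σ i ^ 2) ∧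
      μ[fun ω => Complex.exp (t * f ω) | F n] ω = Complex.exp (t * (μ[f | F n] ω : ℝ)) * Complex.exp Ψ := by
  have hfm : Measurable f := (hf0.mono (hFle 0)).measurable
  filter_upwards [ae_condExpKernel_dressing_eq_exp_of_incrementBound hF hFle hf0 hR hfR n hσ,
    condExp_cexp_mul_ae_eq_complexMGF_condExpKernel (μ := μ) (hFle n) hfm hfR t,
    condExp_ae_eq_integral_condExpKernel_of_bounded (μ := μ) (hFle n) hfm hfR] with ω h1 h2 h3
  obtain ⟨Ψ, hΨ, hZ⟩ := h1 t ht
  refine ⟨Ψ, hΨ, ?_⟩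
  rw [h2, h3, hZ]

/-- [folklore] **THE (A4) FORM OF (AZ), variance budget.**  Under `IncrementVarBound μ F f n v`, for each complex
`‖t‖ < 1/(4R)`: `μ[e^{tf} ∣ F n] = e^{t·μ[f∣F n]}·e^{Ψ}` a.e. with `‖Ψ‖ ≤ 8‖t‖²·Σ_{i<n} v_i`. -/
theorem ae_condExp_cexp_dressing_of_incrementVarBound (hF : Antitone F) (hFle : ∀ j, F j ≤ mΩ)
    {f : Ω → ℝ} (hf0 : StronglyMeasurable[F 0] f) {R : ℝ} (hR : 0 < R) (hfR : ∀ ω, |f ω| ≤ R) (n : ℕ)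
    {v : ℕ → ℝ} (hv : IncrementVarBound μ F f n v) {t : ℂ} (ht : ‖t‖ < (2 * R)⁻¹ / 2) :
    ∀ᵐ ω ∂μ, ∃ Ψ : ℂ, ‖Ψ‖ ≤ 8 * ‖t‖ ^ 2 * (∑ i ∈ Finset.range n, v i) ∧
      μ[fun ω => Complex.exp (t * f ω) | F n] ω = Complex.exp (t * (μ[f | F n] ω : ℝ)) * Complex.exp Ψ := by
  have hfm : Measurable f := (hf0.mono (hFle 0)).measurable
  filter_upwards [ae_condExpKernel_dressing_eq_exp_of_incrementVarBound hF hFle hf0 hR hfR n hv,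
    condExp_cexp_mul_ae_eq_complexMGF_condExpKernel (μ := μ) (hFle n) hfm hfR t,
    condExp_ae_eq_integral_condExpKernel_of_bounded (μ := μ) (hFle n) hfm hfR] with ω h1 h2 h3
  obtain ⟨Ψ, hΨ, hZ⟩ := h1 t ht
  refine ⟨Ψ, hΨ, ?_⟩
  rw [h2, h3, hZ]

end KernelBridge

/-! ## §5  COMPLEX-VALUED bounded centred variables: `t ↦ E_ν[e^{tY}]` along a complex line (the tool for the
ℓ¹-polydisc of §6: a finite family of loops with complex weights `z_C` is ONE complex variable `Y = Σ_C z_C(f_C − m_C)`) -/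

section ComplexValued

variable {Ω : Type*} {mΩ : MeasurableSpace Ω} {ν : Measure Ω} {Y : Ω → ℂ} {b : ℝ}

/-- [folklore] Pointwise sector bound, complex form: `‖w‖ ≤ 1` ⇒ `e^{-1}cos 1 ≤ Re e^{w}`. -/
theorem re_cexp_ge_of_norm_le_one {w : ℂ} (hw : ‖w‖ ≤ 1) :
    Real.exp (-1) * Real.cos 1 ≤ (Complex.exp w).re := by
  rw [Complex.exp_re]
  have h1 : |w.re| ≤ 1 := (Complex.abs_re_le_norm w).trans hw
  have h2 : |w.im| ≤ 1 := (Complex.abs_im_le_norm w).trans hw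
  have hexp : Real.exp (-1) ≤ Real.exp w.re := Real.exp_le_exp.mpr (abs_le.mp h1).1
  have hcos : Real.cos 1 ≤ Real.cos w.im := by
    rw [← Real.cos_abs w.im]
    exact Real.cos_le_cos_of_nonneg_of_le_pi (abs_nonneg _) (by linarith [Real.pi_gt_three]) h2
  have hcos1 : 0 ≤ Real.cos 1 :=
    Real.cos_nonneg_of_mem_Icc ⟨by linarith [Real.pi_gt_three], by linarith [Real.pi_gt_three]⟩
  exact mul_le_mul hexp hcos hcos1 (Real.exp_pos _).le

/-- [folklore] `‖e^{ty}‖ = e^{Re(ty)} ≤ e^{‖t‖·b}` for `‖y‖ ≤ b`. -/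
theorem norm_cexp_mul_le {t y : ℂ} (hy : ‖y‖ ≤ b) : ‖Complex.exp (t * y)‖ ≤ Real.exp (‖t‖ * b) := by
  rw [Complex.norm_exp]
  refine Real.exp_le_exp.mpr (((le_abs_self _).trans (Complex.abs_re_le_norm _)).trans ?_)
  rw [norm_mul]
  exact mul_le_mul_of_nonneg_left hy (norm_nonneg t)

/-- [folklore] The integrand `e^{tY}` of a bounded complex variable is integrable under a finite measure. -/
theorem integrable_cexp_mul [IsFiniteMeasure ν] (hYm : AEMeasurable Y ν) (hYb : ∀ᵐ ω ∂ν, ‖Y ω‖ ≤ b) (t : ℂ) :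
    Integrable (fun ω => Complex.exp (t * Y ω)) ν :=
  Integrable.of_bound (Complex.measurable_exp.comp_aemeasurable (hYm.const_mul t)).aestronglyMeasurable
    (Real.exp (‖t‖ * b)) (hYb.mono fun _ hω => norm_cexp_mul_le hω)

/-- [folklore] **Differentiation under the integral.**  `‖Y‖ ≤ b` a.e. under a finite measure ⇒
`t ↦ E_ν[e^{tY}]` has the complex derivative `E_ν[Y e^{tY}]` at every `t₀ : ℂ`
(`hasDerivAt_integral_of_dominated_loc_of_deriv_le` on the ball `‖t − t₀‖ < 1`, dominated by the constant
`|b|·e^{(‖t₀‖+1)|b|}`). -/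
theorem hasDerivAt_integral_cexp_mul [IsFiniteMeasure ν] (hYm : AEMeasurable Y ν)
    (hYb : ∀ᵐ ω ∂ν, ‖Y ω‖ ≤ b) (t₀ : ℂ) :
    HasDerivAt (fun t => ∫ ω, Complex.exp (t * Y ω) ∂ν) (∫ ω, Y ω * Complex.exp (t₀ * Y ω) ∂ν) t₀ := by
  refine (hasDerivAt_integral_of_dominated_loc_of_deriv_le (F := fun t ω => Complex.exp (t * Y ω))
    (F' := fun t ω => Y ω * Complex.exp (t * Y ω)) (bound := fun _ => |b| * Real.exp ((‖t₀‖ + 1) * |b|))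
    (ball_mem_nhds t₀ one_pos) ?_ (integrable_cexp_mul hYm hYb t₀) ?_ ?_ (integrable_const _) ?_).2
  · exact Eventually.of_forall fun t =>
      (Complex.measurable_exp.comp_aemeasurable (hYm.const_mul t)).aestronglyMeasurable
  · exact (hYm.mul (Complex.measurable_exp.comp_aemeasurable (hYm.const_mul t₀))).aestronglyMeasurable
  · filter_upwards [hYb] with ω hω t ht
    have ht' : ‖t‖ ≤ ‖t₀‖ + 1 := by
      have h1 : ‖t - t₀‖ < 1 := mem_ball_iff_norm.mp ht
      calc ‖t‖ = ‖t₀ + (t - t₀)‖ := by rw [add_sub_cancel]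
        _ ≤ ‖t₀‖ + ‖t - t₀‖ := norm_add_le _ _
        _ ≤ ‖t₀‖ + 1 := by linarith
    have hb' : ‖Y ω‖ ≤ |b| := hω.trans (le_abs_self b)
    rw [norm_mul]
    calc ‖Y ω‖ * ‖Complex.exp (t * Y ω)‖ ≤ |b| * Real.exp (‖t‖ * |b|) :=
          mul_le_mul hb' (norm_cexp_mul_le hb') (norm_nonneg _) (abs_nonneg b)
      _ ≤ |b| * Real.exp ((‖t₀‖ + 1) * |b|) :=
          mul_le_mul_of_nonneg_left
            (Real.exp_le_exp.mpr (mul_le_mul_of_nonneg_right ht' (abs_nonneg b))) (abs_nonneg b)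
  · exact Eventually.of_forall fun ω t _ =>
      ((Complex.hasDerivAt_exp (t * Y ω)).comp t (hasDerivAt_mul_const (Y ω))).congr_deriv (mul_comm _ _)

/-- [folklore] `t ↦ E_ν[e^{tY}]` is ENTIRE for a bounded complex `Y`. -/
theorem differentiable_integral_cexp_mul [IsFiniteMeasure ν] (hYm : AEMeasurable Y ν)
    (hYb : ∀ᵐ ω ∂ν, ‖Y ω‖ ≤ b) : Differentiable ℂ fun t => ∫ ω, Complex.exp (t * Y ω) ∂ν := fun t =>
  (hasDerivAt_integral_cexp_mul hYm hYb t).differentiableAt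

/-- [folklore] Value `1` at `t = 0` under a probability measure. -/
theorem integral_cexp_zero_mul [IsProbabilityMeasure ν] :
    (∫ ω, Complex.exp ((0 : ℂ) * Y ω) ∂ν) = 1 := by
  simp

/-- [folklore] Derivative `E_ν Y = 0` at `t = 0` for a CENTRED bounded complex variable. -/
theorem hasDerivAt_integral_cexp_mul_zero_of_centred [IsFiniteMeasure ν] (hYm : AEMeasurable Y ν)
    (hYb : ∀ᵐ ω ∂ν, ‖Y ω‖ ≤ b) (hYc : ∫ ω, Y ω ∂ν = 0) :
    HasDerivAt (fun t => ∫ ω, Complex.exp (t * Y ω) ∂ν) 0 0 := by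
  have h := hasDerivAt_integral_cexp_mul hYm hYb 0
  have hint : ∫ ω, Y ω * Complex.exp (0 * Y ω) ∂ν = 0 := by simp [hYc]
  rwa [hint] at h

/-- [folklore] **Sector lemma, complex form.**  `‖Y‖ ≤ b` a.e. under a probability measure and `‖t‖·b ≤ 1` ⇒
`e^{-1}cos 1 ≤ Re E_ν[e^{tY}]`. -/
theorem re_integral_cexp_mul_ge [IsProbabilityMeasure ν] (hYm : AEMeasurable Y ν)
    (hYb : ∀ᵐ ω ∂ν, ‖Y ω‖ ≤ b) {t : ℂ} (htb : ‖t‖ * b ≤ 1) :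
    Real.exp (-1) * Real.cos 1 ≤ (∫ ω, Complex.exp (t * Y ω) ∂ν).re := by
  have hint := integrable_cexp_mul hYm hYb t
  have hre : (∫ ω, Complex.exp (t * Y ω) ∂ν).re = ∫ ω, (Complex.exp (t * Y ω)).re ∂ν := by
    have h := integral_re hint
    simpa using h.symm
  rw [hre]
  have hconst : ∫ _ω, Real.exp (-1) * Real.cos 1 ∂ν = Real.exp (-1) * Real.cos 1 := by
    simp [integral_const]
  rw [← hconst]
  refine integral_mono_ae (integrable_const _) ?_ ?_
  · simpa using hint.re
  · filter_upwards [hYb] with ω hω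
    refine re_cexp_ge_of_norm_le_one ?_
    rw [norm_mul]
    calc ‖t‖ * ‖Y ω‖ ≤ ‖t‖ * b := mul_le_mul_of_nonneg_left hω (norm_nonneg t)
      _ ≤ 1 := htb

/-- [folklore] `E_ν[e^{tY}] ∈ slitPlane` for `‖t‖·b ≤ 1`. -/
theorem integral_cexp_mul_mem_slitPlane [IsProbabilityMeasure ν] (hYm : AEMeasurable Y ν)
    (hYb : ∀ᵐ ω ∂ν, ‖Y ω‖ ≤ b) {t : ℂ} (htb : ‖t‖ * b ≤ 1) :
    (∫ ω, Complex.exp (t * Y ω) ∂ν) ∈ Complex.slitPlane :=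
  Complex.mem_slitPlane_iff.mpr
    (Or.inl (exp_neg_one_mul_cos_one_pos.trans_le (re_integral_cexp_mul_ge hYm hYb htb)))

/-- [folklore] `E_ν[e^{tY}] ≠ 0` for `‖t‖·b ≤ 1`. -/
theorem integral_cexp_mul_ne_zero [IsProbabilityMeasure ν] (hYm : AEMeasurable Y ν)
    (hYb : ∀ᵐ ω ∂ν, ‖Y ω‖ ≤ b) {t : ℂ} (htb : ‖t‖ * b ≤ 1) : (∫ ω, Complex.exp (t * Y ω) ∂ν) ≠ 0 :=
  Complex.slitPlane_ne_zero (integral_cexp_mul_mem_slitPlane hYm hYb htb)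

/-- [folklore] `t ↦ log E_ν[e^{tY}]` is holomorphic on the disc `‖t‖ < b⁻¹` (`b > 0`). -/
theorem differentiableOn_log_integral_cexp_mul [IsProbabilityMeasure ν] (hYm : AEMeasurable Y ν) (hb : 0 < b)
    (hYb : ∀ᵐ ω ∂ν, ‖Y ω‖ ≤ b) :
    DifferentiableOn ℂ (fun t => Complex.log (∫ ω, Complex.exp (t * Y ω) ∂ν)) (ball 0 b⁻¹) := fun t ht =>
  ((differentiable_integral_cexp_mul hYm hYb t).clog
    (integral_cexp_mul_mem_slitPlane hYm hYb
      (norm_mul_le_one_of_lt_inv hb (mem_ball_zero_iff.mp ht)))).differentiableWithinAt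

/-- [folklore] **Real part of the cumulant function from the bound on `E_ν e^{Re(τY)}`.**
`‖E_ν e^{tY}‖ ≤ E_ν e^{Re(tY)} ≤ e^{B‖t‖²}` ⇒ `Re log E_ν[e^{tY}] ≤ B‖t‖²` on `‖t‖ < b⁻¹`. -/
theorem re_log_integral_cexp_mul_le [IsProbabilityMeasure ν] (hYm : AEMeasurable Y ν) (hb : 0 < b)
    (hYb : ∀ᵐ ω ∂ν, ‖Y ω‖ ≤ b) {B : ℝ}
    (hB : ∀ τ : ℂ, ‖τ‖ < b⁻¹ → ∫ ω, Real.exp ((τ * Y ω).re) ∂ν ≤ Real.exp (B * ‖τ‖ ^ 2))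
    {t : ℂ} (ht : ‖t‖ < b⁻¹) :
    (Complex.log (∫ ω, Complex.exp (t * Y ω) ∂ν)).re ≤ B * ‖t‖ ^ 2 := by
  rw [Complex.log_re]
  have hpos : 0 < ‖∫ ω, Complex.exp (t * Y ω) ∂ν‖ :=
    norm_pos_iff.mpr (integral_cexp_mul_ne_zero hYm hYb (norm_mul_le_one_of_lt_inv hb ht))
  have hle : ‖∫ ω, Complex.exp (t * Y ω) ∂ν‖ ≤ ∫ ω, Real.exp ((t * Y ω).re) ∂ν := by
    have h := norm_integral_le_integral_norm (μ := ν) fun ω => Complex.exp (t * Y ω)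
    simpa only [Complex.norm_exp] using h
  calc Real.log ‖∫ ω, Complex.exp (t * Y ω) ∂ν‖ ≤ Real.log (Real.exp (B * ‖t‖ ^ 2)) :=
        Real.log_le_log hpos (hle.trans (hB t ht))
    _ = B * ‖t‖ ^ 2 := Real.log_exp _

/-- [folklore] **Jensen by the tangent line, complex form.**  For a CENTRED bounded complex `Y` and real `s`:
`1 ≤ E_ν e^{Re(sY)} = E_ν e^{s·Re Y}` (`Re Y` is a real bounded centred variable; `one_le_mgf_of_centred`). -/
theorem one_le_integral_exp_re_ofReal_mul [IsProbabilityMeasure ν] (hYm : AEMeasurable Y ν)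
    (hYb : ∀ᵐ ω ∂ν, ‖Y ω‖ ≤ b) (hYc : ∫ ω, Y ω ∂ν = 0) (s : ℝ) :
    1 ≤ ∫ ω, Real.exp ((((s : ℝ) : ℂ) * Y ω).re) ∂ν := by
  have hYi : Integrable Y ν := Integrable.of_bound hYm.aestronglyMeasurable b hYb
  have hre0 : ∫ ω, (Y ω).re ∂ν = 0 := by
    have h := integral_re hYi
    rw [hYc] at h
    simpa using h
  have h1 := one_le_mgf_of_centred (S := fun ω => (Y ω).re) (b := b)
    (Complex.measurable_re.comp_aemeasurable hYm)
    (hYb.mono fun ω hω => (Complex.abs_re_le_norm _).trans hω) hre0 s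
  have hfun : ∀ ω, (((s : ℝ) : ℂ) * Y ω).re = s * (Y ω).re := fun ω => by simp [Complex.mul_re]
  simp_rw [hfun]
  simpa [mgf] using h1

/-- [folklore] The quadratic constant of a CENTRED variable is automatically `≥ 0`. -/
theorem quadConst_nonneg_of_centred [IsProbabilityMeasure ν] (hYm : AEMeasurable Y ν) (hb : 0 < b)
    (hYb : ∀ᵐ ω ∂ν, ‖Y ω‖ ≤ b) (hYc : ∫ ω, Y ω ∂ν = 0) {B : ℝ}
    (hB : ∀ τ : ℂ, ‖τ‖ < b⁻¹ → ∫ ω, Real.exp ((τ * Y ω).re) ∂ν ≤ Real.exp (B * ‖τ‖ ^ 2)) : 0 ≤ B := by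
  have hR : 0 < b⁻¹ := inv_pos.mpr hb
  have hnorm : ‖((b⁻¹ / 2 : ℝ) : ℂ)‖ = b⁻¹ / 2 := by
    rw [Complex.norm_real, Real.norm_of_nonneg (by positivity)]
  have hs : ‖((b⁻¹ / 2 : ℝ) : ℂ)‖ < b⁻¹ := by rw [hnorm]; linarith
  have h : 1 ≤ Real.exp (B * (b⁻¹ / 2) ^ 2) := by
    have h' := (one_le_integral_exp_re_ofReal_mul hYm hYb hYc (b⁻¹ / 2)).trans (hB _ hs)
    rwa [hnorm] at h'
  rw [Real.one_le_exp_iff] at h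
  by_contra hB'
  have : B * (b⁻¹ / 2) ^ 2 < 0 := mul_neg_of_neg_of_pos (not_le.mp hB') (by positivity)
  linarith

/-- [folklore] **MAIN THEOREM, COMPLEX-VALUED FORM.**  `ν` a probability measure, `Y : Ω → ℂ` with `‖Y‖ ≤ b` a.e.
(`b > 0`), `E_ν Y = 0`, and `E_ν e^{Re(τY)} ≤ e^{B‖τ‖²}` for complex `‖τ‖ < b⁻¹` ⇒ for `‖t‖ < b⁻¹/2`:
`‖log E_ν[e^{tY}]‖ ≤ 8·B·‖t‖²` (quadratic Borel–Carathéodory, §1, exactly as in `norm_log_complexMGF_le`). -/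
theorem norm_log_integral_cexp_mul_le [IsProbabilityMeasure ν] (hYm : AEMeasurable Y ν) (hb : 0 < b)
    (hYb : ∀ᵐ ω ∂ν, ‖Y ω‖ ≤ b) (hYc : ∫ ω, Y ω ∂ν = 0) {B : ℝ}
    (hB : ∀ τ : ℂ, ‖τ‖ < b⁻¹ → ∫ ω, Real.exp ((τ * Y ω).re) ∂ν ≤ Real.exp (B * ‖τ‖ ^ 2))
    {t : ℂ} (ht : ‖t‖ < b⁻¹ / 2) :
    ‖Complex.log (∫ ω, Complex.exp (t * Y ω) ∂ν)‖ ≤ 8 * B * ‖t‖ ^ 2 := by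
  have hR : 0 < b⁻¹ := inv_pos.mpr hb
  have hB0 : 0 ≤ B := quadConst_nonneg_of_centred hYm hb hYb hYc hB
  set G : ℂ → ℂ := fun t => Complex.log (∫ ω, Complex.exp (t * Y ω) ∂ν) with hG
  have hd : DifferentiableOn ℂ G (ball 0 b⁻¹) := differentiableOn_log_integral_cexp_mul hYm hb hYb
  have hG0 : G 0 = 0 := by
    show Complex.log (∫ ω, Complex.exp ((0 : ℂ) * Y ω) ∂ν) = 0
    rw [integral_cexp_zero_mul (Y := Y), Complex.log_one]
  have hG1 : HasDerivAt G 0 0 := by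
    have hZ := hasDerivAt_integral_cexp_mul_zero_of_centred hYm hYb hYc
    have hslit : (∫ ω, Complex.exp ((0 : ℂ) * Y ω) ∂ν) ∈ Complex.slitPlane := by
      rw [integral_cexp_zero_mul (Y := Y)]; exact Complex.one_mem_slitPlane
    simpa using hZ.clog hslit
  refine le_of_forall_pos_le_add fun ε hε => ?_
  obtain ⟨δ, hδpos, hδε⟩ : ∃ δ : ℝ, 0 < δ ∧ 8 * ‖t‖ ^ 2 * δ ≤ ε := by
    refine ⟨ε / (8 * ‖t‖ ^ 2 + 1), div_pos hε (by positivity), ?_⟩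
    rw [mul_div_assoc', div_le_iff₀ (by positivity)]
    nlinarith [sq_nonneg ‖t‖, hε.le]
  have hApos : 0 < (B + δ) * b⁻¹ ^ 2 := by positivity
  have hre : MapsTo G (ball 0 b⁻¹) {w | w.re ≤ (B + δ) * b⁻¹ ^ 2} := by
    intro w hw
    have hw' : ‖w‖ < b⁻¹ := mem_ball_zero_iff.mp hw
    have h2 : ‖w‖ ^ 2 ≤ b⁻¹ ^ 2 := pow_le_pow_left₀ (norm_nonneg _) hw'.le 2
    show (Complex.log (∫ ω, Complex.exp (w * Y ω) ∂ν)).re ≤ (B + δ) * b⁻¹ ^ 2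
    calc (Complex.log (∫ ω, Complex.exp (w * Y ω) ∂ν)).re ≤ B * ‖w‖ ^ 2 :=
          re_log_integral_cexp_mul_le hYm hb hYb hB hw'
      _ ≤ B * b⁻¹ ^ 2 := mul_le_mul_of_nonneg_left h2 hB0
      _ ≤ (B + δ) * b⁻¹ ^ 2 := by nlinarith [sq_nonneg b⁻¹, hδpos.le]
  have hmain : ‖G t‖ ≤ 8 * ((B + δ) * b⁻¹ ^ 2) * ‖t‖ ^ 2 / b⁻¹ ^ 2 :=
    norm_le_of_mapsTo_re_le hR hApos hd hre hG0 hG1 ht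
  have hb2 : b⁻¹ ^ 2 ≠ 0 := pow_ne_zero 2 hR.ne'
  have heq : 8 * ((B + δ) * b⁻¹ ^ 2) * ‖t‖ ^ 2 / b⁻¹ ^ 2 = 8 * B * ‖t‖ ^ 2 + 8 * ‖t‖ ^ 2 * δ := by
    field_simp
  have hGt : G t = Complex.log (∫ ω, Complex.exp (t * Y ω) ∂ν) := rfl
  rw [← hGt]
  linarith

/-- [folklore] **Exponential form, complex-valued.**  Under the hypotheses of `norm_log_integral_cexp_mul_le`:
`E_ν[e^{tY}] = e^{Ψ}`, `‖Ψ‖ ≤ 8B‖t‖²`, for `‖t‖ < b⁻¹/2`. -/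
theorem integral_cexp_mul_eq_exp [IsProbabilityMeasure ν] (hYm : AEMeasurable Y ν) (hb : 0 < b)
    (hYb : ∀ᵐ ω ∂ν, ‖Y ω‖ ≤ b) (hYc : ∫ ω, Y ω ∂ν = 0) {B : ℝ}
    (hB : ∀ τ : ℂ, ‖τ‖ < b⁻¹ → ∫ ω, Real.exp ((τ * Y ω).re) ∂ν ≤ Real.exp (B * ‖τ‖ ^ 2))
    {t : ℂ} (ht : ‖t‖ < b⁻¹ / 2) :
    ∃ Ψ : ℂ, ‖Ψ‖ ≤ 8 * B * ‖t‖ ^ 2 ∧ (∫ ω, Complex.exp (t * Y ω) ∂ν) = Complex.exp Ψ := by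
  have hR : 0 < b⁻¹ := inv_pos.mpr hb
  refine ⟨_, norm_log_integral_cexp_mul_le hYm hb hYb hYc hB ht, ?_⟩
  exact (Complex.exp_log (integral_cexp_mul_ne_zero hYm hYb (norm_mul_le_one_of_lt_inv hb (by linarith)))).symm

end ComplexValued

/-! ## §6  THE ℓ¹-POLYDISC: a finite family of sources with complex weights (H2/O4 format: loops `C ∈ 𝒞`,
`|z_C|·‖W_C‖_∞` summable with `Σ_C ‖z_C‖ R_C < 1/4`) -/

section MultiSource

variable {Ω : Type*} {mΩ : MeasurableSpace Ω} {ν : Measure Ω} [IsProbabilityMeasure ν] {ι : Type*} [Fintype ι]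

/-- [folklore] Real part along the line: `Re(τ·Σ_C z_C x_C) = Σ_C Re(τ z_C)·x_C` for real `x_C`. -/
theorem re_mul_sum_mul_ofReal (τ : ℂ) (z : ι → ℂ) (x : ι → ℝ) :
    (τ * ∑ C, z C * (x C : ℂ)).re = ∑ C, (τ * z C).re * x C := by
  rw [Finset.mul_sum, Complex.re_sum]
  refine Finset.sum_congr rfl fun C _ => ?_
  rw [← mul_assoc, Complex.re_mul_ofReal]

/-- [folklore] **Continuity in the coefficient vector.**  For bounded measurable `f_C` under a finite measure,
`a ↦ E_ν exp(Σ_C a_C f_C)` is continuous on `ℝ^ι` (dominated convergence on unit balls of the sup norm). -/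
theorem continuous_integral_exp_sum {κ : Measure Ω} [IsFiniteMeasure κ] {f : ι → Ω → ℝ}
    (hfm : ∀ C, Measurable (f C)) {R : ι → ℝ} (hfR : ∀ C ω, |f C ω| ≤ R C) :
    Continuous fun a : ι → ℝ => ∫ y, Real.exp (∑ C, a C * f C y) ∂κ := by
  refine continuous_iff_continuousAt.mpr fun a => ?_
  refine continuousAt_of_dominated (bound := fun _ => Real.exp (∑ C, (|a C| + 1) * R C)) ?_ ?_
    (integrable_const _) ?_
  · exact Eventually.of_forall fun x =>
      (Real.measurable_exp.comp (Finset.measurable_fun_sum _ fun C _ => (hfm C).const_mul (x C))).aestronglyMeasurable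
  · filter_upwards [Metric.ball_mem_nhds a one_pos] with x hx
    refine Eventually.of_forall fun y => ?_
    rw [Real.norm_eq_abs, Real.abs_exp]
    refine Real.exp_le_exp.mpr (Finset.sum_le_sum fun C _ => ?_)
    have hxC : |x C| ≤ |a C| + 1 := by
      have h1 : |x C - a C| ≤ ‖x - a‖ := by
        have h := norm_le_pi_norm (x - a) C
        rwa [Pi.sub_apply, Real.norm_eq_abs] at h
      have h2 : ‖x - a‖ < 1 := mem_ball_iff_norm.mp hx
      calc |x C| = |a C + (x C - a C)| := by rw [add_sub_cancel]
        _ ≤ |a C| + |x C - a C| := abs_add_le _ _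
        _ ≤ |a C| + 1 := by linarith
    calc x C * f C y ≤ |x C * f C y| := le_abs_self _
      _ = |x C| * |f C y| := abs_mul _ _
      _ ≤ (|a C| + 1) * R C := mul_le_mul hxC (hfR C y) (abs_nonneg _) (by positivity)
  · exact Eventually.of_forall fun y =>
      (Real.continuous_exp.comp
        (continuous_finsetSum _ fun C _ => (continuous_apply C).mul continuous_const)).continuousAt

/-- [folklore] **MULTI-SOURCE DRESSING ON THE ℓ¹-POLYDISC.**  `ν` a probability measure, `f_C` (`C ∈ ι` finite) with
`|f_C| ≤ R_C` a.e., complex weights with `Σ_C ‖z_C‖ R_C < 1/4`, and the REAL bound about the means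
`E_ν exp(Σ_C Re(τ z_C)(f_C − E_ν f_C)) ≤ e^{V‖τ‖²}` for complex `τ` with `‖τ‖·2Σ_C‖z_C‖R_C < 1` (a bound for the
REAL combinations `Σ_C a_C f_C`, `a_C = Re(τ z_C)` — what the conditional Azuma–Hoeffding sandwich of
`T4PathwiseCoupling` gives with `V = ½Σ_i(Σ_C ‖z_C‖σ_{C,i})²`) ⇒
`E_ν[exp(Σ_C z_C f_C)] = exp(Σ_C z_C E_ν f_C) · e^{Ψ}` with `‖Ψ‖ ≤ 8V`.
Proof: §5 for the ONE complex variable `Y = Σ_C z_C (f_C − E_ν f_C)` (`‖Y‖ ≤ 2Σ‖z_C‖R_C < 1/2`) at `t = 1`. -/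
theorem multiSource_dressing_eq_exp {f : ι → Ω → ℝ} (hfm : ∀ C, AEMeasurable (f C) ν) {R : ι → ℝ}
    (hfR : ∀ C, ∀ᵐ ω ∂ν, |f C ω| ≤ R C) {z : ι → ℂ} (hz : ∑ C, ‖z C‖ * R C < 1 / 4) {V : ℝ}
    (hV : ∀ τ : ℂ, ‖τ‖ * (2 * ∑ C, ‖z C‖ * R C) < 1 →
      ∫ ω, Real.exp (∑ C, (τ * z C).re * (f C ω - ∫ ω', f C ω' ∂ν)) ∂ν ≤ Real.exp (V * ‖τ‖ ^ 2)) :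
    ∃ Ψ : ℂ, ‖Ψ‖ ≤ 8 * V ∧
      ∫ ω, Complex.exp (∑ C, z C * f C ω) ∂ν =
        Complex.exp (∑ C, z C * (∫ ω, f C ω ∂ν : ℝ)) * Complex.exp Ψ := by
  set m : ι → ℝ := fun C => ∫ ω, f C ω ∂ν with hm
  set b₀ : ℝ := 2 * ∑ C, ‖z C‖ * R C with hb₀
  set b : ℝ := max b₀ (1 / 4) with hb
  have hb_pos : 0 < b := lt_max_of_lt_right (by norm_num)
  have hb₀_le : b₀ ≤ b := le_max_left _ _
  have hb_lt : b < 1 / 2 := max_lt (by rw [hb₀]; linarith) (by norm_num)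
  have hfi : ∀ C, Integrable (f C) ν := fun C =>
    Integrable.of_bound (hfm C).aestronglyMeasurable (R C)
      ((hfR C).mono fun ω h => by simpa [Real.norm_eq_abs] using h)
  have hmR : ∀ C, |m C| ≤ R C := fun C => by
    have h := norm_integral_le_of_norm_le_const (μ := ν) (f := f C) (C := R C)
      ((hfR C).mono fun ω h => by simpa [Real.norm_eq_abs] using h)
    simpa [Real.norm_eq_abs, hm] using h
  -- the ONE complex variable along the line
  set Y : Ω → ℂ := fun ω => ∑ C, z C * ((f C ω : ℂ) - (m C : ℂ)) with hY
  have hYm : AEMeasurable Y ν :=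
    Finset.aemeasurable_fun_sum _ fun C _ =>
      ((Complex.measurable_ofReal.comp_aemeasurable (hfm C)).sub_const _).const_mul _
  have hall : ∀ᵐ ω ∂ν, ∀ C, |f C ω| ≤ R C := eventually_all.mpr hfR
  have hYb : ∀ᵐ ω ∂ν, ‖Y ω‖ ≤ b := by
    filter_upwards [hall] with ω hω
    refine le_trans ?_ hb₀_le
    calc ‖Y ω‖ ≤ ∑ C, ‖z C * ((f C ω : ℂ) - (m C : ℂ))‖ := norm_sum_le _ _
      _ ≤ ∑ C, ‖z C‖ * (2 * R C) := Finset.sum_le_sum fun C _ => by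
          rw [norm_mul]
          refine mul_le_mul_of_nonneg_left ?_ (norm_nonneg _)
          rw [← Complex.ofReal_sub, Complex.norm_real, Real.norm_eq_abs]
          calc |f C ω - m C| ≤ |f C ω| + |m C| := abs_sub _ _
            _ ≤ R C + R C := add_le_add (hω C) (hmR C)
            _ = 2 * R C := by ring
      _ = b₀ := by
          rw [hb₀, Finset.mul_sum]
          exact Finset.sum_congr rfl fun C _ => by ring
  have hYc : ∫ ω, Y ω ∂ν = 0 := by
    have hint : ∀ C, Integrable (fun ω => z C * ((f C ω : ℂ) - (m C : ℂ))) ν := fun C =>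
      (((hfi C).ofReal).sub (integrable_const _)).const_mul _
    show ∫ ω, ∑ C, z C * ((f C ω : ℂ) - (m C : ℂ)) ∂ν = 0
    rw [integral_finsetSum _ fun C _ => hint C]
    refine Finset.sum_eq_zero fun C _ => ?_
    rw [integral_const_mul, integral_sub (hfi C).ofReal (integrable_const _), integral_const,
      integral_complex_ofReal]
    simp [hm]
  have hre : ∀ τ : ℂ, ∀ ω, (τ * Y ω).re = ∑ C, (τ * z C).re * (f C ω - m C) := fun τ ω => by
    have h := re_mul_sum_mul_ofReal τ z fun C => f C ω - m C
    simpa only [hY, Complex.ofReal_sub] using h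
  have hBY : ∀ τ : ℂ, ‖τ‖ < b⁻¹ → ∫ ω, Real.exp ((τ * Y ω).re) ∂ν ≤ Real.exp (V * ‖τ‖ ^ 2) := by
    intro τ hτ
    have hτb : ‖τ‖ * b₀ < 1 :=
      calc ‖τ‖ * b₀ ≤ ‖τ‖ * b := mul_le_mul_of_nonneg_left hb₀_le (norm_nonneg τ)
        _ < b⁻¹ * b := mul_lt_mul_of_pos_right hτ hb_pos
        _ = 1 := inv_mul_cancel₀ hb_pos.ne'
    simp_rw [hre τ]
    exact hV τ hτb
  have h2 : 2 < b⁻¹ := by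
    rw [← one_div, lt_div_iff₀ hb_pos]; linarith
  have h1 : ‖(1 : ℂ)‖ < b⁻¹ / 2 := by rw [norm_one]; linarith
  have hmain := norm_log_integral_cexp_mul_le hYm hb_pos hYb hYc hBY h1
  have hne : (∫ ω, Complex.exp (1 * Y ω) ∂ν) ≠ 0 :=
    integral_cexp_mul_ne_zero hYm hYb (by rw [norm_one, one_mul]; linarith)
  refine ⟨Complex.log (∫ ω, Complex.exp (1 * Y ω) ∂ν), by simpa using hmain, ?_⟩
  rw [Complex.exp_log hne, ← integral_const_mul]
  refine integral_congr_ae (Eventually.of_forall fun ω => ?_)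
  show Complex.exp (∑ C, z C * f C ω) = Complex.exp (∑ C, z C * (m C : ℂ)) * Complex.exp (1 * Y ω)
  rw [← Complex.exp_add, one_mul, hY]
  congr 1
  dsimp only
  rw [← Finset.sum_add_distrib]
  exact Finset.sum_congr rfl fun C _ => by ring

end MultiSource

/-! ## §7  The polydisc on the fibres of the endpoint: `IncrementBound` for every loop of a finite family ⇒ the
multi-source factorisation, a.e., simultaneously for ALL weight vectors in the ℓ¹-polydisc -/

section LinearCombination

open Literature.MathematicalPhysics.QuantumFieldTheory.Balaban1983to89.T4MeanChannel (incr incr_apply)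
open Literature.MathematicalPhysics.QuantumFieldTheory.Balaban1983to89.T4PathwiseCoupling (IncrementBound)

variable {Ω : Type*} {mΩ : MeasurableSpace Ω} {μ : Measure Ω} {F : ℕ → MeasurableSpace Ω}
  {ι : Type*} [Fintype ι]

/-- [folklore] Conditional expectation of a real linear combination, a.e.: `μ[Σ_C a_C f_C ∣ m] = Σ_C a_C μ[f_C ∣ m]`. -/
theorem condExp_linearCombination_ae_eq (m : MeasurableSpace Ω) {f : ι → Ω → ℝ}
    (hfi : ∀ C, Integrable (f C) μ) (a : ι → ℝ) :
    μ[fun ω => ∑ C, a C * f C ω | m] =ᵐ[μ] fun ω => ∑ C, a C * μ[f C | m] ω := by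
  have h2 : ∀ᵐ ω ∂μ, ∀ C, μ[a C • f C | m] ω = a C * μ[f C | m] ω := by
    refine eventually_all.mpr fun C => ?_
    filter_upwards [condExp_smul (a C) (f C) m] with ω hω
    rw [hω, Pi.smul_apply, smul_eq_mul]
  have h1 : (fun ω => ∑ C, a C * f C ω) = ∑ C, a C • f C := by
    funext ω
    simp only [Finset.sum_apply, Pi.smul_apply, smul_eq_mul]
  rw [h1]
  filter_upwards [condExp_finsetSum (fun C _ => (hfi C).smul (a C)) m, h2] with ω h3 h4
  rw [h3, Finset.sum_apply]
  exact Finset.sum_congr rfl fun C _ => h4 C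

/-- [folklore] **The Doob–Lévy increments are linear, a.e.:** `incr(Σ_C a_C f_C) i = Σ_C a_C incr(f_C) i`. -/
theorem incr_linearCombination_ae_eq {f : ι → Ω → ℝ} (hfi : ∀ C, Integrable (f C) μ) (a : ι → ℝ) (i : ℕ) :
    incr μ F (fun ω => ∑ C, a C * f C ω) i =ᵐ[μ] fun ω => ∑ C, a C * incr μ F (f C) i ω := by
  filter_upwards [condExp_linearCombination_ae_eq (μ := μ) (F i) hfi a,
    condExp_linearCombination_ae_eq (μ := μ) (F (i + 1)) hfi a] with ω h1 h2
  rw [incr_apply, h1, h2, ← Finset.sum_sub_distrib]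
  exact Finset.sum_congr rfl fun C _ => by rw [incr_apply]; ring

/-- [folklore] **`IncrementBound` for every source ⇒ `IncrementBound` for every real combination**, with the ℓ¹-weighted
widths `σ_i(a) = Σ_C |a_C| σ_{C,i}`. -/
theorem incrementBound_linearCombination {f : ι → Ω → ℝ} (hfi : ∀ C, Integrable (f C) μ) (n : ℕ)
    {σ : ι → ℕ → ℝ} (hσ : ∀ C, IncrementBound μ F (f C) n (σ C)) (a : ι → ℝ) :
    IncrementBound μ F (fun ω => ∑ C, a C * f C ω) n (fun i => ∑ C, |a C| * σ C i) := by
  intro i hi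
  have hall : ∀ᵐ ω ∂μ, ∀ C, |incr μ F (f C) i ω| ≤ σ C i := eventually_all.mpr fun C => hσ C i hi
  filter_upwards [incr_linearCombination_ae_eq (F := F) hfi a i, hall] with ω h1 h2
  rw [h1]
  calc |∑ C, a C * incr μ F (f C) i ω| ≤ ∑ C, |a C * incr μ F (f C) i ω| := Finset.abs_sum_le_sum_abs _ _
    _ = ∑ C, |a C| * |incr μ F (f C) i ω| := Finset.sum_congr rfl fun C _ => abs_mul _ _
    _ ≤ ∑ C, |a C| * σ C i := Finset.sum_le_sum fun C _ => mul_le_mul_of_nonneg_left (h2 C) (abs_nonneg _)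

end LinearCombination

section KernelMulti

open Literature.MathematicalPhysics.QuantumFieldTheory.Balaban1983to89.T4PathwiseCoupling
  (IncrementBound condExp_exp_dressing_sandwich)

-- the sub-σ-algebra slot `m` BEFORE the ambient `mΩ` (cf. §4)
variable {Ω : Type*} {m : MeasurableSpace Ω} {mΩ : MeasurableSpace Ω} [StandardBorelSpace Ω] {μ : Measure Ω}
  [IsFiniteMeasure μ] {F : ℕ → MeasurableSpace Ω} {ι : Type*} [Fintype ι]

/-- [folklore] **END-TO-END ON THE POLYDISC: `IncrementBound` for each loop of a finite family ⇒ the multi-source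
COMPLEX dressing factorisation on the fibres of the endpoint, a.e., SIMULTANEOUSLY for all weight vectors `z` with
`Σ_C ‖z_C‖ R_C < 1/4`.**  `Ω` standard Borel, `μ` finite, `F` antitone with `F j ≤ mΩ`, `f_C` `F 0`-measurable with
`|f_C| ≤ R_C`, `IncrementBound μ F f_C n σ_C` for every `C` ⇒ for `μ`-a.e. `ω` and every such `z`:
`E_{κ_ω}[exp(Σ_C z_C f_C)] = exp(Σ_C z_C E_{κ_ω} f_C) · e^{Ψ}`, `‖Ψ‖ ≤ 4·Σ_{i<n}(Σ_C ‖z_C‖ σ_{C,i})²`,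
`κ = condExpKernel μ (F n)`.  Proof: `incrementBound_linearCombination` + `condExp_exp_dressing_sandwich` (real
combinations, `t = 1`), read on the fibres for the countably many RATIONAL coefficient vectors, extended to all real
ones by continuity (`continuous_integral_exp_sum`, `DenseRange.piMap`), then §6 fibrewise.  The single-loop case is
`ae_condExpKernel_dressing_eq_exp_of_incrementBound` (`4‖t‖²Σσ²`). -/
theorem ae_condExpKernel_multiSource_eq_exp_of_incrementBound (hF : Antitone F) (hFle : ∀ j, F j ≤ mΩ)
    {f : ι → Ω → ℝ} (hf0 : ∀ C, StronglyMeasurable[F 0] (f C)) {R : ι → ℝ} (hfR : ∀ C ω, |f C ω| ≤ R C)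
    (n : ℕ) {σ : ι → ℕ → ℝ} (hσ : ∀ C, IncrementBound μ F (f C) n (σ C)) :
    ∀ᵐ ω ∂μ, ∀ z : ι → ℂ, ∑ C, ‖z C‖ * R C < 1 / 4 →
      ∃ Ψ : ℂ, ‖Ψ‖ ≤ 4 * ∑ i ∈ Finset.range n, (∑ C, ‖z C‖ * σ C i) ^ 2 ∧
        ∫ y, Complex.exp (∑ C, z C * f C y) ∂(condExpKernel μ (F n) ω) =
          Complex.exp (∑ C, z C * (∫ y, f C y ∂(condExpKernel μ (F n) ω) : ℝ)) * Complex.exp Ψ := by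
  -- the degenerate case `μ = 0`
  rcases eq_or_ne μ 0 with hμ | hμ
  · subst hμ
    rw [ae_zero]
    exact Filter.eventually_bot
  have hσnn : ∀ C, ∀ i < n, 0 ≤ σ C i := fun C i hi => by
    haveI : (ae μ).NeBot := ae_neBot.mpr hμ
    obtain ⟨ω, hω⟩ := (hσ C i hi).exists
    exact (abs_nonneg _).trans hω
  have hfm : ∀ C, Measurable (f C) := fun C => ((hf0 C).mono (hFle 0)).measurable
  have hfi : ∀ C, Integrable (f C) μ := fun C =>
    Integrable.of_bound (hfm C).aestronglyMeasurable (R C)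
      (ae_of_all μ fun ω => by simpa [Real.norm_eq_abs] using hfR C ω)
  -- real combinations
  have hg0 : ∀ a : ι → ℝ, StronglyMeasurable[F 0] (fun ω => ∑ C, a C * f C ω) := fun a =>
    Finset.stronglyMeasurable_fun_sum _ fun C _ => (hf0 C).const_mul (a C)
  have hgR : ∀ (a : ι → ℝ) ω, |∑ C, a C * f C ω| ≤ ∑ C, |a C| * R C := fun a ω =>
    calc |∑ C, a C * f C ω| ≤ ∑ C, |a C * f C ω| := Finset.abs_sum_le_sum_abs _ _
      _ = ∑ C, |a C| * |f C ω| := Finset.sum_congr rfl fun C _ => abs_mul _ _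
      _ ≤ ∑ C, |a C| * R C := Finset.sum_le_sum fun C _ => mul_le_mul_of_nonneg_left (hfR C ω) (abs_nonneg _)
  have hgm : ∀ a : ι → ℝ, Measurable (fun ω => ∑ C, a C * f C ω) := fun a => ((hg0 a).mono (hFle 0)).measurable
  have hgi : ∀ a : ι → ℝ, Integrable (fun ω => ∑ C, a C * f C ω) μ := fun a =>
    Integrable.of_bound (hgm a).aestronglyMeasurable (∑ C, |a C| * R C)
      (ae_of_all μ fun ω => by simpa [Real.norm_eq_abs] using hgR a ω)
  have hexpi : ∀ a : ι → ℝ, Integrable (fun ω => Real.exp (1 * ∑ C, a C * f C ω)) μ := fun a =>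
    integrable_exp_mul_of_mem_Icc (hgm a).aemeasurable
      (ae_of_all μ fun ω => Set.mem_Icc.mpr (abs_le.mp (hgR a ω)))
  -- fibre means of the sources are linear (everywhere)
  have hmean_lin : ∀ (a : ι → ℝ) ω, ∫ y, ∑ C, a C * f C y ∂(condExpKernel μ (F n) ω) =
      ∑ C, a C * ∫ y, f C y ∂(condExpKernel μ (F n) ω) := fun a ω => by
    have hfiκ : ∀ C, Integrable (f C) (condExpKernel μ (F n) ω) := fun C =>
      Integrable.of_bound (hfm C).aestronglyMeasurable (R C)
        (ae_of_all _ fun y => by simpa [Real.norm_eq_abs] using hfR C y)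
    rw [integral_finsetSum _ fun C _ => (hfiκ C).const_mul (a C)]
    exact Finset.sum_congr rfl fun C _ => integral_const_mul _ _
  -- the real sandwich at `t = 1` for every RATIONAL coefficient vector, read on the fibres
  have hrat : ∀ᵐ ω ∂μ, ∀ q : ι → ℚ,
      ∫ y, Real.exp (∑ C, (q C : ℝ) * f C y) ∂(condExpKernel μ (F n) ω) ≤
        Real.exp (∑ C, (q C : ℝ) * ∫ y, f C y ∂(condExpKernel μ (F n) ω)) *
          Real.exp ((∑ i ∈ Finset.range n, (∑ C, |(q C : ℝ)| * σ C i) ^ 2) / 2) := by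
    rw [ae_all_iff]
    intro q
    set a : ι → ℝ := fun C => (q C : ℝ) with ha
    have hsand := (condExp_exp_dressing_sandwich (μ := μ) hF hFle (hg0 a) (hgR a) n
      (incrementBound_linearCombination (F := F) hfi n hσ a) 1).2
    have hcexp : μ[fun ω => Real.exp (1 * ∑ C, a C * f C ω) | F n] =ᵐ[μ]
        fun ω => ∫ y, Real.exp (1 * ∑ C, a C * f C y) ∂(condExpKernel μ (F n) ω) :=
      condExp_ae_eq_integral_condExpKernel (hFle n) (hexpi a)
    have hcmean : μ[fun ω => ∑ C, a C * f C ω | F n] =ᵐ[μ]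
        fun ω => ∫ y, ∑ C, a C * f C y ∂(condExpKernel μ (F n) ω) :=
      condExp_ae_eq_integral_condExpKernel (hFle n) (hgi a)
    filter_upwards [hsand, hcexp, hcmean] with ω h1 h2 h3
    rw [h2, h3, hmean_lin a ω] at h1
    simpa only [one_mul, one_pow, ha] using h1
  filter_upwards [hrat] with ω hω z hz
  -- extension from rational to real coefficient vectors
  set κ := condExpKernel μ (F n) ω with hκ
  have hreal : ∀ a : ι → ℝ, ∫ y, Real.exp (∑ C, a C * f C y) ∂κ ≤
      Real.exp (∑ C, a C * ∫ y, f C y ∂κ) *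
        Real.exp ((∑ i ∈ Finset.range n, (∑ C, |a C| * σ C i) ^ 2) / 2) := by
    intro a
    have hd : DenseRange (fun (q : ι → ℚ) (C : ι) => (q C : ℝ)) :=
      DenseRange.piMap fun _ => Rat.denseRange_cast
    refine hd.induction_on (p := fun a : ι → ℝ => ∫ y, Real.exp (∑ C, a C * f C y) ∂κ ≤
      Real.exp (∑ C, a C * ∫ y, f C y ∂κ) *
        Real.exp ((∑ i ∈ Finset.range n, (∑ C, |a C| * σ C i) ^ 2) / 2)) a ?_ hω
    exact isClosed_le (continuous_integral_exp_sum (κ := κ) hfm hfR) (by fun_prop)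
  -- the hypothesis of §6 with `V = ½ Σ_i (Σ_C ‖z_C‖ σ_{C,i})²`
  set V : ℝ := (∑ i ∈ Finset.range n, (∑ C, ‖z C‖ * σ C i) ^ 2) / 2 with hV
  have hVhyp : ∀ τ : ℂ, ‖τ‖ * (2 * ∑ C, ‖z C‖ * R C) < 1 →
      ∫ y, Real.exp (∑ C, (τ * z C).re * (f C y - ∫ y', f C y' ∂κ)) ∂κ ≤ Real.exp (V * ‖τ‖ ^ 2) := by
    intro τ _
    set a : ι → ℝ := fun C => (τ * z C).re with ha
    set mκ : ι → ℝ := fun C => ∫ y', f C y' ∂κ with hmκ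
    have hsplit : (fun y => Real.exp (∑ C, a C * (f C y - mκ C))) =
        fun y => Real.exp (-∑ C, a C * mκ C) * Real.exp (∑ C, a C * f C y) := by
      funext y
      rw [← Real.exp_add]
      congr 1
      rw [← Finset.sum_neg_distrib, ← Finset.sum_add_distrib]
      exact Finset.sum_congr rfl fun C _ => by ring
    have hQ : (∑ i ∈ Finset.range n, (∑ C, |a C| * σ C i) ^ 2) ≤
        ‖τ‖ ^ 2 * ∑ i ∈ Finset.range n, (∑ C, ‖z C‖ * σ C i) ^ 2 := by
      rw [Finset.mul_sum]
      refine Finset.sum_le_sum fun i hi => ?_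
      have hi' : i < n := Finset.mem_range.mp hi
      have h0 : 0 ≤ ∑ C, |a C| * σ C i :=
        Finset.sum_nonneg fun C _ => mul_nonneg (abs_nonneg _) (hσnn C i hi')
      have hle : ∑ C, |a C| * σ C i ≤ ‖τ‖ * ∑ C, ‖z C‖ * σ C i := by
        rw [Finset.mul_sum]
        refine Finset.sum_le_sum fun C _ => ?_
        rw [← mul_assoc, ← norm_mul]
        exact mul_le_mul_of_nonneg_right (Complex.abs_re_le_norm _) (hσnn C i hi')
      calc (∑ C, |a C| * σ C i) ^ 2 ≤ (‖τ‖ * ∑ C, ‖z C‖ * σ C i) ^ 2 := pow_le_pow_left₀ h0 hle 2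
        _ = ‖τ‖ ^ 2 * (∑ C, ‖z C‖ * σ C i) ^ 2 := by ring
    show ∫ y, Real.exp (∑ C, a C * (f C y - mκ C)) ∂κ ≤ Real.exp (V * ‖τ‖ ^ 2)
    rw [hsplit, integral_const_mul]
    calc Real.exp (-∑ C, a C * mκ C) * ∫ y, Real.exp (∑ C, a C * f C y) ∂κ
        ≤ Real.exp (-∑ C, a C * mκ C) * (Real.exp (∑ C, a C * mκ C) *
            Real.exp ((∑ i ∈ Finset.range n, (∑ C, |a C| * σ C i) ^ 2) / 2)) :=
          mul_le_mul_of_nonneg_left (hreal a) (Real.exp_pos _).le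
      _ = Real.exp ((∑ i ∈ Finset.range n, (∑ C, |a C| * σ C i) ^ 2) / 2) := by
          rw [← mul_assoc, ← Real.exp_add, neg_add_cancel, Real.exp_zero, one_mul]
      _ ≤ Real.exp (V * ‖τ‖ ^ 2) := by
          refine Real.exp_le_exp.mpr ?_
          rw [hV]
          nlinarith [hQ]
  obtain ⟨Ψ, hΨ, hZ⟩ := multiSource_dressing_eq_exp (ν := κ) (fun C => (hfm C).aemeasurable)
    (fun C => ae_of_all _ (hfR C)) hz hVhyp
  refine ⟨Ψ, hΨ.trans_eq ?_, hZ⟩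
  rw [hV]; ring

/-- [folklore] **THE (A4) POLYDISC FORM OF (AZ).**  Under `IncrementBound μ F f_C n σ_C` for every loop `C` of a
finite family and `Σ_C ‖z_C‖ R_C < 1/4`:
`μ[exp(Σ_C z_C f_C) ∣ F n] = exp(Σ_C z_C μ[f_C ∣ F n]) · e^{Ψ}` a.e., `‖Ψ‖ ≤ 4Σ_{i<n}(Σ_C ‖z_C‖σ_{C,i})²` —
DRESSED = UNDRESSED × `exp(Σ_C z_C h_C + Ψ(z))` with the joint fluctuation channel quadratically small in the
ℓ¹-weighted ℓ² budget, for every weight vector of the polydisc. -/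
theorem ae_condExp_cexp_multiSource_of_incrementBound (hF : Antitone F) (hFle : ∀ j, F j ≤ mΩ)
    {f : ι → Ω → ℝ} (hf0 : ∀ C, StronglyMeasurable[F 0] (f C)) {R : ι → ℝ} (hfR : ∀ C ω, |f C ω| ≤ R C)
    (n : ℕ) {σ : ι → ℕ → ℝ} (hσ : ∀ C, IncrementBound μ F (f C) n (σ C)) {z : ι → ℂ}
    (hz : ∑ C, ‖z C‖ * R C < 1 / 4) :
    ∀ᵐ ω ∂μ, ∃ Ψ : ℂ, ‖Ψ‖ ≤ 4 * ∑ i ∈ Finset.range n, (∑ C, ‖z C‖ * σ C i) ^ 2 ∧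
      μ[fun ω => Complex.exp (∑ C, z C * f C ω) | F n] ω =
        Complex.exp (∑ C, z C * (μ[f C | F n] ω : ℝ)) * Complex.exp Ψ := by
  have hfm : ∀ C, Measurable (f C) := fun C => ((hf0 C).mono (hFle 0)).measurable
  -- the complex integrand is bounded, hence integrable; its conditional expectation is the fibre integral
  have hint : Integrable (fun ω => Complex.exp (∑ C, z C * f C ω)) μ := by
    refine Integrable.of_bound ?_ (Real.exp (∑ C, ‖z C‖ * R C)) (ae_of_all μ fun ω => ?_)
    · exact (Complex.measurable_exp.comp (Finset.measurable_fun_sum _ fun C _ =>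
        (Complex.measurable_ofReal.comp (hfm C)).const_mul (z C))).aestronglyMeasurable
    · rw [Complex.norm_exp, Complex.re_sum]
      refine Real.exp_le_exp.mpr (Finset.sum_le_sum fun C _ => ?_)
      calc (z C * (f C ω : ℂ)).re ≤ ‖z C * (f C ω : ℂ)‖ := (le_abs_self _).trans (Complex.abs_re_le_norm _)
        _ = ‖z C‖ * |f C ω| := by rw [norm_mul, Complex.norm_real, Real.norm_eq_abs]
        _ ≤ ‖z C‖ * R C := mul_le_mul_of_nonneg_left (hfR C ω) (norm_nonneg _)
  have hcexp : μ[fun ω => Complex.exp (∑ C, z C * f C ω) | F n] =ᵐ[μ]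
      fun ω => ∫ y, Complex.exp (∑ C, z C * f C y) ∂(condExpKernel μ (F n) ω) :=
    condExp_ae_eq_integral_condExpKernel (hFle n) hint
  have hmeans : ∀ᵐ ω ∂μ, ∀ C, μ[f C | F n] ω = ∫ y, f C y ∂(condExpKernel μ (F n) ω) :=
    eventually_all.mpr fun C =>
      condExp_ae_eq_integral_condExpKernel_of_bounded (μ := μ) (hFle n) (hfm C) (hfR C)
  filter_upwards [ae_condExpKernel_multiSource_eq_exp_of_incrementBound hF hFle hf0 hfR n hσ, hcexp, hmeans]
    with ω h1 h2 h3
  obtain ⟨Ψ, hΨ, hZ⟩ := h1 z hz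
  refine ⟨Ψ, hΨ, ?_⟩
  have hsum : (∑ C, z C * ((μ[f C | F n] ω : ℝ) : ℂ)) =
      ∑ C, z C * ((∫ y, f C y ∂(condExpKernel μ (F n) ω) : ℝ) : ℂ) :=
    Finset.sum_congr rfl fun C _ => by rw [h3 C]
  rw [h2, hZ, hsum]

end KernelMulti

/-! ## §7b  The VARIANCE FORM of the polydisc: `IncrementVarBound` for every loop ⇒ for every real combination
(weighted Cauchy–Schwarz, square-root free), and the fibrewise factorisation with `‖Ψ(z)‖ ≤ 8Σ_i(Σ_C‖z_C‖√v_{C,i})²` -/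

section LinearCombinationVar

open Literature.MathematicalPhysics.QuantumFieldTheory.Balaban1983to89.T4MeanChannel
  (incr incr_apply ae_abs_incr_le aestronglyMeasurable_incr integrable_incr_mul_incr)
open Literature.MathematicalPhysics.QuantumFieldTheory.Balaban1983to89.T4PathwiseCoupling (IncrementVarBound)

variable {Ω : Type*} {mΩ : MeasurableSpace Ω} {μ : Measure Ω} [IsFiniteMeasure μ] {F : ℕ → MeasurableSpace Ω}
  {ι : Type*} [Fintype ι]

omit [IsFiniteMeasure μ] in
/-- [folklore] **Weighted Cauchy–Schwarz, square-root free:** for weights `w_C > 0`,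
`(Σ_C a_C y_C)² ≤ (Σ_C |a_C| w_C) · Σ_C (|a_C| / w_C) y_C²`
(Mathlib's `Finset.sum_sq_le_sum_mul_sum_of_sq_le_mul` with `r_C = a_C y_C`, `f_C = |a_C| w_C`, `g_C = (|a_C|/w_C) y_C²`). -/
theorem sq_sum_mul_le_weighted (a y : ι → ℝ) {w : ι → ℝ} (hw : ∀ C, 0 < w C) :
    (∑ C, a C * y C) ^ 2 ≤ (∑ C, |a C| * w C) * ∑ C, |a C| / w C * y C ^ 2 := by
  refine Finset.sum_sq_le_sum_mul_sum_of_sq_le_mul _ (fun C _ => mul_nonneg (abs_nonneg _) (hw C).le)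
    (fun C _ => mul_nonneg (div_nonneg (abs_nonneg _) (hw C).le) (sq_nonneg _)) fun C _ => le_of_eq ?_
  have hwC : w C ≠ 0 := (hw C).ne'
  calc (a C * y C) ^ 2 = |a C| * |a C| * y C ^ 2 * (w C / w C) := by
        rw [div_self hwC, mul_one, mul_pow, ← sq_abs (a C)]; ring
    _ = |a C| * w C * (|a C| / w C * y C ^ 2) := by ring

/-- [folklore] **`IncrementVarBound` for every source ⇒ `IncrementVarBound` for every real combination**, with the
ℓ¹-weighted widths: if `μ[(incr f_C)_i² ∣ F(i+1)] ≤ w_{C,i}²` (`w_{C,i} > 0`) for every `C`, then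
`μ[(incr Σ_C a_C f_C)_i² ∣ F(i+1)] ≤ (Σ_C |a_C| w_{C,i})²` a.e.  NO conditional Minkowski / Cauchy–Schwarz inequality is
used: the increment of the combination is the combination of the increments a.e. (`incr_linearCombination_ae_eq`), the
POINTWISE weighted Cauchy–Schwarz `sq_sum_mul_le_weighted` gives `(Σ a_C Y_C)² ≤ (Σ|a_C|w_C)·Σ_C(|a_C|/w_C)Y_C²`, and the
right-hand side is handled by monotonicity and linearity of the conditional expectation alone. -/
theorem incrementVarBound_linearCombination (hF : Antitone F) (hFle : ∀ j, F j ≤ mΩ) {f : ι → Ω → ℝ}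
    (hfi : ∀ C, Integrable (f C) μ) {R : ι → ℝ} (hfR : ∀ C ω, |f C ω| ≤ R C) (n : ℕ) {w : ι → ℕ → ℝ}
    (hw : ∀ C, ∀ i < n, 0 < w C i) (hv : ∀ C, IncrementVarBound μ F (f C) n (fun i => w C i ^ 2))
    (a : ι → ℝ) :
    IncrementVarBound μ F (fun ω => ∑ C, a C * f C ω) n (fun i => (∑ C, |a C| * w C i) ^ 2) := by
  intro i hi
  have hwi : ∀ C, 0 < w C i := fun C => hw C i hi
  -- the increments of the sources at level `i`, their squares and bounds
  have hYsq : ∀ C, Integrable (fun ω => incr μ F (f C) i ω ^ 2) μ := fun C =>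
    (integrable_incr_mul_incr hF hFle (hfR C) (f C) i i).congr (ae_of_all _ fun ω => (sq _).symm)
  have hYb : ∀ᵐ ω ∂μ, ∀ C, |incr μ F (f C) i ω| ≤ 2 * R C :=
    eventually_all.mpr fun C => ae_abs_incr_le (hfR C) i
  -- the combination of the increments: square-integrable (bounded)
  have hlhs : Integrable (fun ω => (∑ C, a C * incr μ F (f C) i ω) ^ 2) μ := by
    refine Integrable.of_bound ?_ ((∑ C, |a C| * (2 * R C)) ^ 2) ?_
    · exact ((Finset.aestronglyMeasurable_fun_sum _ fun C _ =>
        (aestronglyMeasurable_incr hF hFle (f C) i).const_mul (a C)).aemeasurable.pow_const 2).aestronglyMeasurable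
    · filter_upwards [hYb] with ω hω
      rw [Real.norm_eq_abs, abs_pow]
      refine pow_le_pow_left₀ (abs_nonneg _) ?_ 2
      calc |∑ C, a C * incr μ F (f C) i ω| ≤ ∑ C, |a C * incr μ F (f C) i ω| := Finset.abs_sum_le_sum_abs _ _
        _ = ∑ C, |a C| * |incr μ F (f C) i ω| := Finset.sum_congr rfl fun C _ => abs_mul _ _
        _ ≤ ∑ C, |a C| * (2 * R C) :=
            Finset.sum_le_sum fun C _ => mul_le_mul_of_nonneg_left (hω C) (abs_nonneg _)
  have hrhs : Integrable (fun ω => (∑ C, |a C| * w C i) * ∑ C, |a C| / w C i * incr μ F (f C) i ω ^ 2) μ :=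
    (integrable_finsetSum _ fun C _ => (hYsq C).const_mul _).const_mul _
  -- (1) the increment of the combination is the combination of the increments, a.e.
  have hcongr : μ[fun ω => incr μ F (fun ω => ∑ C, a C * f C ω) i ω ^ 2 | F (i + 1)] =ᵐ[μ]
      μ[fun ω => (∑ C, a C * incr μ F (f C) i ω) ^ 2 | F (i + 1)] := by
    refine condExp_congr_ae ?_
    filter_upwards [incr_linearCombination_ae_eq (F := F) hfi a i] with ω hω
    rw [hω]
  -- (2) pointwise weighted Cauchy–Schwarz and monotonicity
  have hmono : μ[fun ω => (∑ C, a C * incr μ F (f C) i ω) ^ 2 | F (i + 1)] ≤ᵐ[μ]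
      μ[fun ω => (∑ C, |a C| * w C i) * ∑ C, |a C| / w C i * incr μ F (f C) i ω ^ 2 | F (i + 1)] :=
    condExp_mono hlhs hrhs (ae_of_all _ fun ω => sq_sum_mul_le_weighted a (fun C => incr μ F (f C) i ω) hwi)
  -- (3) linearity of the conditional expectation
  have hsmul : μ[fun ω => (∑ C, |a C| * w C i) * ∑ C, |a C| / w C i * incr μ F (f C) i ω ^ 2 | F (i + 1)] =ᵐ[μ]
      fun ω => (∑ C, |a C| * w C i) * μ[fun ω => ∑ C, |a C| / w C i * incr μ F (f C) i ω ^ 2 | F (i + 1)] ω := by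
    have hfun : (fun ω => (∑ C, |a C| * w C i) * ∑ C, |a C| / w C i * incr μ F (f C) i ω ^ 2) =
        (∑ C, |a C| * w C i) • fun ω => ∑ C, |a C| / w C i * incr μ F (f C) i ω ^ 2 := by
      funext ω
      simp only [Pi.smul_apply, smul_eq_mul]
    rw [hfun]
    filter_upwards [condExp_smul (μ := μ) (∑ C, |a C| * w C i)
      (fun ω => ∑ C, |a C| / w C i * incr μ F (f C) i ω ^ 2) (F (i + 1))] with ω hω
    rw [hω, Pi.smul_apply, smul_eq_mul]
  have hlin := condExp_linearCombination_ae_eq (μ := μ) (F (i + 1)) hYsq (fun C => |a C| / w C i)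
  -- (4) the hypothesis, for every source at once
  have hvall : ∀ᵐ ω ∂μ, ∀ C, μ[fun ω => incr μ F (f C) i ω ^ 2 | F (i + 1)] ω ≤ w C i ^ 2 :=
    eventually_all.mpr fun C => hv C i hi
  filter_upwards [hcongr, hmono, hsmul, hlin, hvall] with ω h1 h2 h3 h4 h5
  rw [h1]
  refine h2.trans ?_
  rw [h3, h4]
  have hs : 0 ≤ ∑ C, |a C| * w C i := Finset.sum_nonneg fun C _ => mul_nonneg (abs_nonneg _) (hwi C).le
  calc (∑ C, |a C| * w C i) * ∑ C, |a C| / w C i * μ[fun ω => incr μ F (f C) i ω ^ 2 | F (i + 1)] ω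
      ≤ (∑ C, |a C| * w C i) * ∑ C, |a C| / w C i * w C i ^ 2 :=
        mul_le_mul_of_nonneg_left (Finset.sum_le_sum fun C _ =>
          mul_le_mul_of_nonneg_left (h5 C) (div_nonneg (abs_nonneg _) (hwi C).le)) hs
    _ = (∑ C, |a C| * w C i) ^ 2 := by
        rw [sq]
        congr 1
        exact Finset.sum_congr rfl fun C _ => by field_simp

end LinearCombinationVar

section KernelMultiVar

open Literature.MathematicalPhysics.QuantumFieldTheory.Balaban1983to89.T4PathwiseCoupling
  (IncrementVarBound condExp_exp_dressing_sandwich_of_condVar)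

-- the sub-σ-algebra slot `m` BEFORE the ambient `mΩ` (cf. §4)
variable {Ω : Type*} {m : MeasurableSpace Ω} {mΩ : MeasurableSpace Ω} [StandardBorelSpace Ω] {μ : Measure Ω}
  [IsFiniteMeasure μ] {F : ℕ → MeasurableSpace Ω} {ι : Type*} [Fintype ι]

/-- [folklore] **END-TO-END ON THE POLYDISC, VARIANCE FORM: `IncrementVarBound` for each loop of a finite family ⇒ the
multi-source COMPLEX dressing factorisation on the fibres of the endpoint, a.e., SIMULTANEOUSLY for all `z` with
`Σ_C ‖z_C‖ R_C < 1/4`, with `‖Ψ‖ ≤ 8·Σ_{i<n}(Σ_C ‖z_C‖ √v_{C,i})²`.**  Hypotheses as in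
`ae_condExpKernel_multiSource_eq_exp_of_incrementBound` with `IncrementVarBound μ F f_C n v_C` (conditional variances)
in place of `IncrementBound`; NO sup-oscillation input.  Proof: for `ε > 0` the widths `√v_{C,i} + ε` are positive and
dominate the variances, so `incrementVarBound_linearCombination` + `condExp_exp_dressing_sandwich_of_condVar` at `t = 1`
(admissible since `2Σ_C|a_C|R_C ≤ ‖τ‖·2Σ_C‖z_C‖R_C < 1`) give the real bound for every RATIONAL coefficient vector and
every `ε = 1/(k+1)`, read on the fibres; density of `ℚ^ι` in the CLOSED set `{2Σ|a_C|R_C ≥ 1} ∪ {inequality}` and the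
limit `k → ∞` give it for all real vectors with `2Σ|a_C|R_C < 1` and `ε = 0`; then §6 fibrewise.  The single-loop case
is `ae_condExpKernel_dressing_eq_exp_of_incrementVarBound` (`8‖t‖²Σv`). -/
theorem ae_condExpKernel_multiSource_eq_exp_of_incrementVarBound (hF : Antitone F) (hFle : ∀ j, F j ≤ mΩ)
    {f : ι → Ω → ℝ} (hf0 : ∀ C, StronglyMeasurable[F 0] (f C)) {R : ι → ℝ} (hfR : ∀ C ω, |f C ω| ≤ R C)
    (n : ℕ) {v : ι → ℕ → ℝ} (hv : ∀ C, IncrementVarBound μ F (f C) n (v C)) :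
    ∀ᵐ ω ∂μ, ∀ z : ι → ℂ, ∑ C, ‖z C‖ * R C < 1 / 4 →
      ∃ Ψ : ℂ, ‖Ψ‖ ≤ 8 * ∑ i ∈ Finset.range n, (∑ C, ‖z C‖ * Real.sqrt (v C i)) ^ 2 ∧
        ∫ y, Complex.exp (∑ C, z C * f C y) ∂(condExpKernel μ (F n) ω) =
          Complex.exp (∑ C, z C * (∫ y, f C y ∂(condExpKernel μ (F n) ω) : ℝ)) * Complex.exp Ψ := by
  -- the degenerate case `μ = 0`
  rcases eq_or_ne μ 0 with hμ | hμ
  · subst hμ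
    rw [ae_zero]
    exact Filter.eventually_bot
  -- `Ω` is nonempty, so the ranges are `≥ 0`
  have hRnn : ∀ C, 0 ≤ R C := fun C => by
    have hne : Nonempty Ω := by
      by_contra h
      haveI : IsEmpty Ω := not_nonempty_iff.mp h
      exact hμ (Measure.eq_zero_of_isEmpty μ)
    obtain ⟨ω⟩ := hne
    exact (abs_nonneg _).trans (hfR C ω)
  have hfm : ∀ C, Measurable (f C) := fun C => ((hf0 C).mono (hFle 0)).measurable
  have hfi : ∀ C, Integrable (f C) μ := fun C =>
    Integrable.of_bound (hfm C).aestronglyMeasurable (R C)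
      (ae_of_all μ fun ω => by simpa [Real.norm_eq_abs] using hfR C ω)
  -- real combinations
  have hg0 : ∀ a : ι → ℝ, StronglyMeasurable[F 0] (fun ω => ∑ C, a C * f C ω) := fun a =>
    Finset.stronglyMeasurable_fun_sum _ fun C _ => (hf0 C).const_mul (a C)
  have hgR : ∀ (a : ι → ℝ) ω, |∑ C, a C * f C ω| ≤ ∑ C, |a C| * R C := fun a ω =>
    calc |∑ C, a C * f C ω| ≤ ∑ C, |a C * f C ω| := Finset.abs_sum_le_sum_abs _ _
      _ = ∑ C, |a C| * |f C ω| := Finset.sum_congr rfl fun C _ => abs_mul _ _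
      _ ≤ ∑ C, |a C| * R C := Finset.sum_le_sum fun C _ => mul_le_mul_of_nonneg_left (hfR C ω) (abs_nonneg _)
  have hgm : ∀ a : ι → ℝ, Measurable (fun ω => ∑ C, a C * f C ω) := fun a => ((hg0 a).mono (hFle 0)).measurable
  have hgi : ∀ a : ι → ℝ, Integrable (fun ω => ∑ C, a C * f C ω) μ := fun a =>
    Integrable.of_bound (hgm a).aestronglyMeasurable (∑ C, |a C| * R C)
      (ae_of_all μ fun ω => by simpa [Real.norm_eq_abs] using hgR a ω)
  have hexpi : ∀ a : ι → ℝ, Integrable (fun ω => Real.exp (1 * ∑ C, a C * f C ω)) μ := fun a =>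
    integrable_exp_mul_of_mem_Icc (hgm a).aemeasurable
      (ae_of_all μ fun ω => Set.mem_Icc.mpr (abs_le.mp (hgR a ω)))
  -- fibre means of the sources are linear (everywhere)
  have hmean_lin : ∀ (a : ι → ℝ) ω, ∫ y, ∑ C, a C * f C y ∂(condExpKernel μ (F n) ω) =
      ∑ C, a C * ∫ y, f C y ∂(condExpKernel μ (F n) ω) := fun a ω => by
    have hfiκ : ∀ C, Integrable (f C) (condExpKernel μ (F n) ω) := fun C =>
      Integrable.of_bound (hfm C).aestronglyMeasurable (R C)
        (ae_of_all _ fun y => by simpa [Real.norm_eq_abs] using hfR C y)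
    rw [integral_finsetSum _ fun C _ => (hfiκ C).const_mul (a C)]
    exact Finset.sum_congr rfl fun C _ => integral_const_mul _ _
  -- for `ε > 0` the widths `√v + ε` are positive and dominate the conditional variances
  have hvw : ∀ ε : ℝ, 0 < ε → ∀ C, IncrementVarBound μ F (f C) n (fun i => (Real.sqrt (v C i) + ε) ^ 2) := by
    intro ε hε C i hi
    refine (hv C i hi).trans (ae_of_all _ fun ω => ?_)
    show v C i ≤ (Real.sqrt (v C i) + ε) ^ 2
    rcases le_or_gt 0 (v C i) with h0 | h0
    · nlinarith [Real.sq_sqrt h0, Real.sqrt_nonneg (v C i)]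
    · nlinarith [sq_nonneg (Real.sqrt (v C i) + ε)]
  -- the real sandwich (variance form) at `t = 1` for every RATIONAL coefficient vector in range and every `ε = 1/(k+1)`,
  -- read on the fibres
  have hrat : ∀ᵐ ω ∂μ, ∀ k : ℕ, ∀ q : ι → ℚ, 2 * ∑ C, |(q C : ℝ)| * R C ≤ 1 →
      ∫ y, Real.exp (∑ C, (q C : ℝ) * f C y) ∂(condExpKernel μ (F n) ω) ≤
        Real.exp (∑ C, (q C : ℝ) * ∫ y, f C y ∂(condExpKernel μ (F n) ω)) *
          Real.exp (∑ i ∈ Finset.range n, (∑ C, |(q C : ℝ)| * (Real.sqrt (v C i) + 1 / (k + 1 : ℝ))) ^ 2) := by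
    rw [ae_all_iff]
    intro k
    rw [ae_all_iff]
    intro q
    by_cases hq : 2 * ∑ C, |(q C : ℝ)| * R C ≤ 1
    swap
    · exact ae_of_all _ fun ω h => absurd h hq
    set a : ι → ℝ := fun C => (q C : ℝ) with ha
    have hε : (0 : ℝ) < 1 / (k + 1 : ℝ) := by positivity
    have ht : |(1 : ℝ)| * (2 * ∑ C, |a C| * R C) ≤ 1 := by rwa [abs_one, one_mul]
    have hsand := (condExp_exp_dressing_sandwich_of_condVar (μ := μ) hF hFle (hg0 a) (hgR a) n
      (incrementVarBound_linearCombination (F := F) (w := fun C i => Real.sqrt (v C i) + 1 / (k + 1 : ℝ))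
        hF hFle hfi hfR n (fun C i _ => by positivity) (hvw _ hε) a) ht).2
    have hcexp : μ[fun ω => Real.exp (1 * ∑ C, a C * f C ω) | F n] =ᵐ[μ]
        fun ω => ∫ y, Real.exp (1 * ∑ C, a C * f C y) ∂(condExpKernel μ (F n) ω) :=
      condExp_ae_eq_integral_condExpKernel (hFle n) (hexpi a)
    have hcmean : μ[fun ω => ∑ C, a C * f C ω | F n] =ᵐ[μ]
        fun ω => ∫ y, ∑ C, a C * f C y ∂(condExpKernel μ (F n) ω) :=
      condExp_ae_eq_integral_condExpKernel (hFle n) (hgi a)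
    filter_upwards [hsand, hcexp, hcmean] with ω h1 h2 h3 _
    rw [h2, h3, hmean_lin a ω] at h1
    simpa only [one_mul, one_pow, ha] using h1
  filter_upwards [hrat] with ω hω z hz
  set κ := condExpKernel μ (F n) ω with hκ
  -- extension from rational to real coefficient vectors (in range) and `ε ↓ 0`
  have hreal : ∀ a : ι → ℝ, 2 * ∑ C, |a C| * R C < 1 →
      ∫ y, Real.exp (∑ C, a C * f C y) ∂κ ≤ Real.exp (∑ C, a C * ∫ y, f C y ∂κ) *
        Real.exp (∑ i ∈ Finset.range n, (∑ C, |a C| * Real.sqrt (v C i)) ^ 2) := by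
    intro a haR
    have hk : ∀ k : ℕ, ∫ y, Real.exp (∑ C, a C * f C y) ∂κ ≤ Real.exp (∑ C, a C * ∫ y, f C y ∂κ) *
        Real.exp (∑ i ∈ Finset.range n, (∑ C, |a C| * (Real.sqrt (v C i) + 1 / (k + 1 : ℝ))) ^ 2) := by
      intro k
      have hd : DenseRange (fun (q : ι → ℚ) (C : ι) => (q C : ℝ)) :=
        DenseRange.piMap fun _ => Rat.denseRange_cast
      have hP := hd.induction_on
        (p := fun a : ι → ℝ => 1 ≤ 2 * ∑ C, |a C| * R C ∨
          ∫ y, Real.exp (∑ C, a C * f C y) ∂κ ≤ Real.exp (∑ C, a C * ∫ y, f C y ∂κ) *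
            Real.exp (∑ i ∈ Finset.range n, (∑ C, |a C| * (Real.sqrt (v C i) + 1 / (k + 1 : ℝ))) ^ 2))
        a ?_ ?_
      · exact hP.resolve_left (not_le.mpr haR)
      · rw [Set.setOf_or]
        exact (isClosed_le continuous_const (by fun_prop)).union
          (isClosed_le (continuous_integral_exp_sum (κ := κ) hfm hfR) (by fun_prop))
      · intro q
        by_cases hq : 2 * ∑ C, |(q C : ℝ)| * R C ≤ 1
        · exact Or.inr (hω k q hq)
        · exact Or.inl (not_le.mp hq).le
    have hΦc : Continuous fun ε : ℝ => Real.exp (∑ C, a C * ∫ y, f C y ∂κ) *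
        Real.exp (∑ i ∈ Finset.range n, (∑ C, |a C| * (Real.sqrt (v C i) + ε)) ^ 2) := by fun_prop
    have hlim := (hΦc.tendsto 0).comp tendsto_one_div_add_atTop_nhds_zero_nat
    simp only [add_zero] at hlim
    exact ge_of_tendsto' hlim fun k => hk k
  -- the hypothesis of §6 with `V = Σ_i (Σ_C ‖z_C‖ √v_{C,i})²`
  set V : ℝ := ∑ i ∈ Finset.range n, (∑ C, ‖z C‖ * Real.sqrt (v C i)) ^ 2 with hV
  have hVhyp : ∀ τ : ℂ, ‖τ‖ * (2 * ∑ C, ‖z C‖ * R C) < 1 →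
      ∫ y, Real.exp (∑ C, (τ * z C).re * (f C y - ∫ y', f C y' ∂κ)) ∂κ ≤ Real.exp (V * ‖τ‖ ^ 2) := by
    intro τ hτ
    set a : ι → ℝ := fun C => (τ * z C).re with ha
    set mκ : ι → ℝ := fun C => ∫ y', f C y' ∂κ with hmκ
    -- the combination is in range: `2Σ|a_C|R_C ≤ ‖τ‖·2Σ‖z_C‖R_C < 1`
    have haR : 2 * ∑ C, |a C| * R C < 1 := by
      have hle : ∑ C, |a C| * R C ≤ ∑ C, ‖τ‖ * (‖z C‖ * R C) := Finset.sum_le_sum fun C _ => by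
        rw [← mul_assoc, ← norm_mul]
        exact mul_le_mul_of_nonneg_right (Complex.abs_re_le_norm _) (hRnn C)
      rw [← Finset.mul_sum] at hle
      calc 2 * ∑ C, |a C| * R C ≤ 2 * (‖τ‖ * ∑ C, ‖z C‖ * R C) := by linarith
        _ = ‖τ‖ * (2 * ∑ C, ‖z C‖ * R C) := by ring
        _ < 1 := hτ
    have hsplit : (fun y => Real.exp (∑ C, a C * (f C y - mκ C))) =
        fun y => Real.exp (-∑ C, a C * mκ C) * Real.exp (∑ C, a C * f C y) := by
      funext y
      rw [← Real.exp_add]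
      congr 1
      rw [← Finset.sum_neg_distrib, ← Finset.sum_add_distrib]
      exact Finset.sum_congr rfl fun C _ => by ring
    have hQ : (∑ i ∈ Finset.range n, (∑ C, |a C| * Real.sqrt (v C i)) ^ 2) ≤
        ‖τ‖ ^ 2 * ∑ i ∈ Finset.range n, (∑ C, ‖z C‖ * Real.sqrt (v C i)) ^ 2 := by
      rw [Finset.mul_sum]
      refine Finset.sum_le_sum fun i _ => ?_
      have h0 : 0 ≤ ∑ C, |a C| * Real.sqrt (v C i) :=
        Finset.sum_nonneg fun C _ => mul_nonneg (abs_nonneg _) (Real.sqrt_nonneg _)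
      have hle : ∑ C, |a C| * Real.sqrt (v C i) ≤ ‖τ‖ * ∑ C, ‖z C‖ * Real.sqrt (v C i) := by
        rw [Finset.mul_sum]
        refine Finset.sum_le_sum fun C _ => ?_
        rw [← mul_assoc, ← norm_mul]
        exact mul_le_mul_of_nonneg_right (Complex.abs_re_le_norm _) (Real.sqrt_nonneg _)
      calc (∑ C, |a C| * Real.sqrt (v C i)) ^ 2 ≤ (‖τ‖ * ∑ C, ‖z C‖ * Real.sqrt (v C i)) ^ 2 :=
            pow_le_pow_left₀ h0 hle 2
        _ = ‖τ‖ ^ 2 * (∑ C, ‖z C‖ * Real.sqrt (v C i)) ^ 2 := by ring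
    show ∫ y, Real.exp (∑ C, a C * (f C y - mκ C)) ∂κ ≤ Real.exp (V * ‖τ‖ ^ 2)
    rw [hsplit, integral_const_mul]
    calc Real.exp (-∑ C, a C * mκ C) * ∫ y, Real.exp (∑ C, a C * f C y) ∂κ
        ≤ Real.exp (-∑ C, a C * mκ C) * (Real.exp (∑ C, a C * mκ C) *
            Real.exp (∑ i ∈ Finset.range n, (∑ C, |a C| * Real.sqrt (v C i)) ^ 2)) :=
          mul_le_mul_of_nonneg_left (hreal a haR) (Real.exp_pos _).le
      _ = Real.exp (∑ i ∈ Finset.range n, (∑ C, |a C| * Real.sqrt (v C i)) ^ 2) := by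
          rw [← mul_assoc, ← Real.exp_add, neg_add_cancel, Real.exp_zero, one_mul]
      _ ≤ Real.exp (V * ‖τ‖ ^ 2) := by
          refine Real.exp_le_exp.mpr ?_
          rw [hV]
          linarith [hQ]
  obtain ⟨Ψ, hΨ, hZ⟩ := multiSource_dressing_eq_exp (ν := κ) (fun C => (hfm C).aemeasurable)
    (fun C => ae_of_all _ (hfR C)) hz hVhyp
  exact ⟨Ψ, hΨ, hZ⟩

/-- [folklore] **THE (A4) POLYDISC FORM OF (AZ), VARIANCE BUDGET.**  Under `IncrementVarBound μ F f_C n v_C` for every loop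
`C` of a finite family and `Σ_C ‖z_C‖ R_C < 1/4`:
`μ[exp(Σ_C z_C f_C) ∣ F n] = exp(Σ_C z_C μ[f_C ∣ F n]) · e^{Ψ}` a.e., `‖Ψ‖ ≤ 8Σ_{i<n}(Σ_C ‖z_C‖ √v_{C,i})²` — the joint
fluctuation channel quadratically small in the ℓ¹-weighted CONDITIONAL-VARIANCE budget; range `2R_C` + conditional variances
only, no sup-oscillation input. -/
theorem ae_condExp_cexp_multiSource_of_incrementVarBound (hF : Antitone F) (hFle : ∀ j, F j ≤ mΩ)
    {f : ι → Ω → ℝ} (hf0 : ∀ C, StronglyMeasurable[F 0] (f C)) {R : ι → ℝ} (hfR : ∀ C ω, |f C ω| ≤ R C)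
    (n : ℕ) {v : ι → ℕ → ℝ} (hv : ∀ C, IncrementVarBound μ F (f C) n (v C)) {z : ι → ℂ}
    (hz : ∑ C, ‖z C‖ * R C < 1 / 4) :
    ∀ᵐ ω ∂μ, ∃ Ψ : ℂ, ‖Ψ‖ ≤ 8 * ∑ i ∈ Finset.range n, (∑ C, ‖z C‖ * Real.sqrt (v C i)) ^ 2 ∧
      μ[fun ω => Complex.exp (∑ C, z C * f C ω) | F n] ω =
        Complex.exp (∑ C, z C * (μ[f C | F n] ω : ℝ)) * Complex.exp Ψ := by
  have hfm : ∀ C, Measurable (f C) := fun C => ((hf0 C).mono (hFle 0)).measurable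
  have hint : Integrable (fun ω => Complex.exp (∑ C, z C * f C ω)) μ := by
    refine Integrable.of_bound ?_ (Real.exp (∑ C, ‖z C‖ * R C)) (ae_of_all μ fun ω => ?_)
    · exact (Complex.measurable_exp.comp (Finset.measurable_fun_sum _ fun C _ =>
        (Complex.measurable_ofReal.comp (hfm C)).const_mul (z C))).aestronglyMeasurable
    · rw [Complex.norm_exp, Complex.re_sum]
      refine Real.exp_le_exp.mpr (Finset.sum_le_sum fun C _ => ?_)
      calc (z C * (f C ω : ℂ)).re ≤ ‖z C * (f C ω : ℂ)‖ := (le_abs_self _).trans (Complex.abs_re_le_norm _)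
        _ = ‖z C‖ * |f C ω| := by rw [norm_mul, Complex.norm_real, Real.norm_eq_abs]
        _ ≤ ‖z C‖ * R C := mul_le_mul_of_nonneg_left (hfR C ω) (norm_nonneg _)
  have hcexp : μ[fun ω => Complex.exp (∑ C, z C * f C ω) | F n] =ᵐ[μ]
      fun ω => ∫ y, Complex.exp (∑ C, z C * f C y) ∂(condExpKernel μ (F n) ω) :=
    condExp_ae_eq_integral_condExpKernel (hFle n) hint
  have hmeans : ∀ᵐ ω ∂μ, ∀ C, μ[f C | F n] ω = ∫ y, f C y ∂(condExpKernel μ (F n) ω) :=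
    eventually_all.mpr fun C =>
      condExp_ae_eq_integral_condExpKernel_of_bounded (μ := μ) (hFle n) (hfm C) (hfR C)
  filter_upwards [ae_condExpKernel_multiSource_eq_exp_of_incrementVarBound hF hFle hf0 hfR n hv, hcexp, hmeans]
    with ω h1 h2 h3
  obtain ⟨Ψ, hΨ, hZ⟩ := h1 z hz
  refine ⟨Ψ, hΨ, ?_⟩
  have hsum : (∑ C, z C * ((μ[f C | F n] ω : ℝ) : ℂ)) =
      ∑ C, z C * ((∫ y, f C y ∂(condExpKernel μ (F n) ω) : ℝ) : ℂ) :=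
    Finset.sum_congr rfl fun C _ => by rw [h3 C]
  rw [h2, hZ, hsum]

end KernelMultiVar

end Literature.MathematicalPhysics.QuantumFieldTheory.Balaban1983to89.T4PathwiseCouplingComplex

end
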